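import Literature.Analysis.FluidPDE.BourgainPavlovicPairs
import HarnessLib

/-!
# Coefficient budgets for the Bourgain–Pavlović remainder equation

Eighth support file for the discharge of the barrier
`Literature.Barriers.NavierStokesRegularity.CriticalBesovNormInflation` (Bourgain–Pavlović 2008,
Thm. 1.1). The remainder `y = u − e^{tΔ}u₀ + u₁` of Bourgain–Pavlović's §3.3 solves a linear
equation with coefficients `e^{tΔ}u₀` and `u₁` plus a quadratic term; in our Fourier-side
rendering it is controlled in the band Chemin–Lerner / Lei–Lin path norm of
`NSFourierPathNorm` (`pathNorm`), and the linear terms are small because the coefficients are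
**lacunary**: a coefficient piece of mass `A e^{-κ r}` living at scale `N` acts on the input
band `2^b` with norm `≲ 2^b A/κ` if `2^b ≤ N` (time decay of the coefficient against the sup in
time of the band, `lintegral_massL1_mul_band_le_low`) and `≲ 2^{-b} A` if `2^b > N`
(`lintegral_massL1_mul_band_le_high`); summed over the very lacunary scales `N_s` (ratio `≥ 8`)
these are geometric series, uniformly in the band. This is the Fourier–Lei–Lin substitute for
Bourgain–Pavlović's estimates (3.15)–(3.21) and (3.26)–(3.37) of the linearised operator.

* `sum_lintegral_massL1_mul_le_of_budget`: the generic **budget lemma** for a finite family of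
  coefficients with masses `≤ A_i e^{-κ_i r}` and split scales `N_i`;
* the **lacunary sums** of the scales `N_s = 2^{n_s}`, `n_{s+1} ≥ n_s + 3`:
  `∑_{N_s ≥ L} L/N_s ≤ 8/7`, `∑_{N_s < L} N_s/L ≤ 8/7`, `∑_{s'} N_s N_{s'}/(N_s² + N_{s'}²) ≤ 11/14`,
  and the pair / triple / quadruple sums derived from them;
* the budgets: the `4r` pieces of the free evolution cost `K_U = 6 α m` (`coefficient_budget_free`),
  the high pair interactions of `u₁` cost `2000 α² m²` (`coefficient_budget_pairs_high`), the
  `8r` low pair interactions cost `48 α² r m² √T` (`coefficient_budget_pairs_low`);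
* the **forcing sizes**: `E₁ = ∫₀ᵀ massL1(u₁) massL1(Uᶜ) ≤ 660 α³ r m³` and
  `E₂ = ∫₀ᵀ massL1(u₁)² ≤ 2304 α⁴ r² m⁴ T + 219000 α⁴ r m⁴` (`forcing_E₁_le`, `forcing_E₂_le`);
  with `α² r = Q²` these are `660 α Q² m³` and `2304 Q⁴ m⁴ T + 219000 α² Q² m⁴`, small once
  `r → ∞` at fixed `Q` and `T ≪ Q⁻⁴` — Bourgain–Pavlović's choice of `r` large and `T = Q⁻³`
  in §3.3.

## References

* J. Bourgain, N. Pavlović, J. Funct. Anal. 255 (2008), §3.3, (3.15)–(3.21), (3.26)–(3.37). [BourgainPavlovic2008]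
* Z. Lei, F. Lin, Comm. Pure Appl. Math. 64 (2011), Thm. 1.1 (the path space). [LeiLin2011]
-/

noncomputable section

open MeasureTheory Real Set Filter Topology Function Complex
open scoped ENNReal NNReal

/-! ### The generic budget lemma -/

namespace Literature.Analysis.FluidPDE.FourierNS

variable {ι : Type*} [Fintype ι] [Nonempty ι]

/-- The band share of `pathNormOne`: `bandOne T y b = ∫₀ᵀ ∫_{band b} ‖ξ‖ ‖y(r,ξ)‖ dξ dr`. [folklore] -/
def bandOne (T : ℝ) (y : ℝ → EuclideanSpace ℝ ι → ι → ℂ) (b : ℤ) : ℝ≥0∞ :=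
  ∫⁻ r in Ioc 0 T, ∫⁻ ξ in band ι b, ‖ξ‖ₑ * ‖y r ξ‖ₑ

/-- The band shares of `pathNormOne` sum to it. [folklore] -/
theorem tsum_bandOne_eq (T : ℝ) {y : ℝ → EuclideanSpace ℝ ι → ι → ℂ} (hy : Continuous (uncurry y)) :
    ∑' b : ℤ, bandOne T y b = pathNormOne T y :=
  tsum_lintegral_band_xPos_eq T hy

/-- **One lacunary coefficient against the path norm, band by band.** If
`massL1 (G r) ≤ A e^{-κ r}` on `(0, T]`, then for any split scale `N > 0`,
`∫₀ᵀ massL1(G r) massL1(y r) dr ≤ ∑_b [2^b ≤ N] (2^{b+1}A/κ) bandSup_b(y) + [2^b > N] (2^{-b}A) bandOne_b(y)`. [folklore] -/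
theorem lintegral_massL1_mul_le_bands {T : ℝ} {G y : ℝ → EuclideanSpace ℝ ι → ι → ℂ}
    (hG : Continuous (uncurry G)) (hy : Continuous (uncurry y)) {A κ : ℝ} (N : ℝ) (hA : 0 ≤ A)
    (hκ : 0 < κ) (hmass : ∀ r ∈ Ioc 0 T, massL1 (G r) ≤ ENNReal.ofReal (A * Real.exp (-κ * r))) :
    ∫⁻ r in Ioc 0 T, massL1 (G r) * massL1 (y r) ≤
      ∑' b : ℤ, (if (2 : ℝ) ^ b ≤ N then ENNReal.ofReal ((2 : ℝ) ^ (b + 1) * A / κ) * bandSup T y b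
        else ENNReal.ofReal ((2 : ℝ) ^ (-b) * A) * bandOne T y b) := by
  rw [lintegral_massL1_mul_massL1_eq_tsum T hG hy]
  refine ENNReal.tsum_le_tsum fun b => ?_
  split_ifs with hb
  · -- low band: time decay of the coefficient
    have hgm : Measurable fun r : ℝ => ENNReal.ofReal (A * Real.exp (-κ * r)) :=
      ENNReal.measurable_ofReal.comp (by fun_prop)
    refine (lintegral_massL1_mul_band_le_low hgm hmass b).trans ?_
    have hI : ∫⁻ r in Ioc 0 T, ENNReal.ofReal (A * Real.exp (-κ * r)) ≤ ENNReal.ofReal (A / κ) := by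
      have : ∀ r, ENNReal.ofReal (A * Real.exp (-κ * r)) =
          ENNReal.ofReal A * ENNReal.ofReal (Real.exp (-κ * r)) := fun r => ENNReal.ofReal_mul hA
      simp_rw [this]
      rw [lintegral_const_mul' _ _ ENNReal.ofReal_ne_top, div_eq_mul_one_div, ENNReal.ofReal_mul hA]
      exact mul_le_mul' le_rfl (lintegral_Ioc_exp_neg_le hκ T)
    calc ENNReal.ofReal ((2 : ℝ) ^ (b + 1)) * (∫⁻ r in Ioc 0 T, ENNReal.ofReal (A * Real.exp (-κ * r))) *
          bandSup T y b
        ≤ ENNReal.ofReal ((2 : ℝ) ^ (b + 1)) * ENNReal.ofReal (A / κ) * bandSup T y b := by gcongr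
      _ = ENNReal.ofReal ((2 : ℝ) ^ (b + 1) * A / κ) * bandSup T y b := by
          rw [← ENNReal.ofReal_mul (by positivity), mul_div_assoc]
  · -- high band: sup of the coefficient
    have hsup : ∀ r ∈ Ioc 0 T, massL1 (G r) ≤ ENNReal.ofReal A := fun r hr =>
      (hmass r hr).trans (ENNReal.ofReal_le_ofReal (by
        have : Real.exp (-κ * r) ≤ 1 := by
          rw [Real.exp_le_one_iff]; nlinarith [hr.1]
        nlinarith))
    refine (lintegral_massL1_mul_band_le_high ENNReal.ofReal_ne_top hsup b).trans ?_
    rw [bandOne, ← ENNReal.ofReal_mul (by positivity)]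

/-- **The budget lemma.** A finite family of lacunary coefficients `G_i` with masses
`≤ A_i e^{-κ_i r}` on `(0, T]` and split scales `N_i` acts on the path norm with norm `≤ K` as
soon as, uniformly in the band `2^b`, `∑_{i : 2^b ≤ N_i} 2^{b+1} A_i/κ_i ≤ K` and
`∑_{i : 2^b > N_i} 2^{-b} A_i ≤ K`:
`∑_i ∫₀ᵀ massL1(G_i r) massL1(y r) dr ≤ K · pathNorm T y`. [folklore] -/
theorem sum_lintegral_massL1_mul_le_of_budget {α : Type*} (S : Finset α) {T : ℝ}
    {G : α → ℝ → EuclideanSpace ℝ ι → ι → ℂ} {y : ℝ → EuclideanSpace ℝ ι → ι → ℂ}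
    (hG : ∀ i ∈ S, Continuous (uncurry (G i))) (hy : Continuous (uncurry y)) {A κ N : α → ℝ}
    (hA : ∀ i ∈ S, 0 ≤ A i) (hκ : ∀ i ∈ S, 0 < κ i)
    (hmass : ∀ i ∈ S, ∀ r ∈ Ioc 0 T, massL1 (G i r) ≤ ENNReal.ofReal (A i * Real.exp (-κ i * r)))
    {K : ℝ≥0∞}
    (hlow : ∀ b : ℤ, ∑ i ∈ S, (if (2 : ℝ) ^ b ≤ N i then ENNReal.ofReal ((2 : ℝ) ^ (b + 1) * A i / κ i)
      else 0) ≤ K)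
    (hhigh : ∀ b : ℤ, ∑ i ∈ S, (if (2 : ℝ) ^ b ≤ N i then 0 else ENNReal.ofReal ((2 : ℝ) ^ (-b) * A i))
      ≤ K) :
    ∑ i ∈ S, ∫⁻ r in Ioc 0 T, massL1 (G i r) * massL1 (y r) ≤ K * pathNorm T y := by
  classical
  set f : α → ℤ → ℝ≥0∞ := fun i b => if (2 : ℝ) ^ b ≤ N i then
      ENNReal.ofReal ((2 : ℝ) ^ (b + 1) * A i / κ i) * bandSup T y b
    else ENNReal.ofReal ((2 : ℝ) ^ (-b) * A i) * bandOne T y b with hf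
  calc ∑ i ∈ S, ∫⁻ r in Ioc 0 T, massL1 (G i r) * massL1 (y r)
      ≤ ∑ i ∈ S, ∑' b : ℤ, f i b :=
        Finset.sum_le_sum fun i hi => lintegral_massL1_mul_le_bands (hG i hi) hy (N i) (hA i hi)
          (hκ i hi) (hmass i hi)
    _ = ∑' b : ℤ, ∑ i ∈ S, f i b :=
        (Summable.tsum_finsetSum fun i _ => ENNReal.summable).symm
    _ ≤ ∑' b : ℤ, (K * bandSup T y b + K * bandOne T y b) := by
        refine ENNReal.tsum_le_tsum fun b => ?_
        have hsplit : ∀ i ∈ S, f i b =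
            (if (2 : ℝ) ^ b ≤ N i then ENNReal.ofReal ((2 : ℝ) ^ (b + 1) * A i / κ i) else 0) *
              bandSup T y b +
            (if (2 : ℝ) ^ b ≤ N i then 0 else ENNReal.ofReal ((2 : ℝ) ^ (-b) * A i)) *
              bandOne T y b := by
          intro i _
          simp only [hf]
          split_ifs <;> simp
        rw [Finset.sum_congr rfl hsplit, Finset.sum_add_distrib, ← Finset.sum_mul, ← Finset.sum_mul]
        exact add_le_add (mul_le_mul' (hlow b) le_rfl) (mul_le_mul' (hhigh b) le_rfl)
    _ = K * pathNorm T y := by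
        rw [ENNReal.tsum_add, ENNReal.tsum_mul_left, ENNReal.tsum_mul_left, tsum_bandOne_eq T hy,
          pathNorm, pathNormInf, mul_add]

end Literature.Analysis.FluidPDE.FourierNS

/-! ### Lacunary sums of the scales -/

namespace Literature.Analysis.FluidPDE.BourgainPavlovic

open FourierNS Literature.Analysis.FunctionSpaces

/-- Local notation for frequency space `ℝ³`. -/
local notation "E3" => EuclideanSpace ℝ (Fin 3)

namespace InflationParams

variable (d : InflationParams)

/-- Lacunarity over `k` steps: `8^k N_s ≤ N_{s+k}`. [cite: BourgainPavlovic2008, §3.1] -/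
theorem pow_mul_N_le (s k : ℕ) : (8 : ℝ) ^ k * d.N s ≤ d.N (s + k) := by
  induction k with
  | zero => simp
  | succ k ih =>
    calc (8 : ℝ) ^ (k + 1) * d.N s = 8 * ((8 : ℝ) ^ k * d.N s) := by ring
      _ ≤ 8 * d.N (s + k) := by linarith
      _ ≤ d.N (s + k + 1) := d.eight_mul_N_le (s + k)

/-- The ratio of two scales: `N_s/N_{s'} ≤ (1/8)^{s'-s}` for `s ≤ s'`. [folklore] -/
theorem N_div_N_le {s s' : ℕ} (h : s ≤ s') : d.N s / d.N s' ≤ (1 / 8 : ℝ) ^ (s' - s) := by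
  obtain ⟨k, rfl⟩ := Nat.exists_eq_add_of_le h
  have h1 := d.pow_mul_N_le s k
  have h2 := d.N_pos (s + k)
  rw [Nat.add_sub_cancel_left, div_le_iff₀ h2, one_div, inv_pow, le_inv_mul_iff₀ (by positivity)]
  exact h1

/-- The finite geometric sums of ratio `1/8` are `≤ 8/7`. [folklore] -/
theorem geom_sum_eighth_le (n : ℕ) : ∑ k ∈ Finset.range n, (1 / 8 : ℝ) ^ k ≤ 8 / 7 := by
  rw [geom_sum_eq (by norm_num) n]
  have h : (0 : ℝ) ≤ (1 / 8 : ℝ) ^ n := by positivity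
  have : ((1 / 8 : ℝ) ^ n - 1) / (1 / 8 - 1) = (8 / 7) * (1 - (1 / 8 : ℝ) ^ n) := by ring
  rw [this]
  nlinarith

/-- The geometric sums without the `k = 0` term are `≤ 1/7`. [folklore] -/
theorem geom_sum_eighth_le' (n : ℕ) :
    ∑ k ∈ (Finset.range n).filter (fun k => 1 ≤ k), (1 / 8 : ℝ) ^ k ≤ 1 / 7 := by
  have h : ∑ k ∈ (Finset.range n).filter (fun k => 1 ≤ k), (1 / 8 : ℝ) ^ k =
      ∑ k ∈ Finset.range n, (1 / 8 : ℝ) ^ k - ∑ k ∈ (Finset.range n).filter (fun k => ¬1 ≤ k), (1 / 8 : ℝ) ^ k := by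
    rw [← Finset.sum_filter_add_sum_filter_not (Finset.range n) (fun k => 1 ≤ k)]
    ring
  rw [h]
  rcases Nat.eq_zero_or_pos n with rfl | hn
  · simp
  · have h0 : (Finset.range n).filter (fun k => ¬1 ≤ k) = {0} := by
      ext k
      simp only [Finset.mem_filter, Finset.mem_range, not_le, Nat.lt_one_iff, Finset.mem_singleton]
      constructor
      · rintro ⟨_, rfl⟩; rfl
      · rintro rfl; exact ⟨hn, rfl⟩
    rw [h0, Finset.sum_singleton, pow_zero]
    linarith [geom_sum_eighth_le n]

/-- **First lacunary sum**: `∑_{s < r, N_s ≥ L} L/N_s ≤ 8/7` for `L > 0`. [cite: BourgainPavlovic2008, §3.1] -/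
theorem lacunary_sum_ge (L : ℝ) :
    ∑ s ∈ Finset.range d.r, (if L ≤ d.N s then L / d.N s else 0) ≤ 8 / 7 := by
  classical
  set A := (Finset.range d.r).filter (fun s => L ≤ d.N s) with hA
  rw [← Finset.sum_filter]
  change ∑ s ∈ A, L / d.N s ≤ 8 / 7
  rcases A.eq_empty_or_nonempty with hE | hne
  · rw [hE, Finset.sum_empty]; norm_num
  · set s₁ := A.min' hne with hs₁
    have hs₁A : s₁ ∈ A := Finset.min'_mem A hne
    have hL₁ : L ≤ d.N s₁ := (Finset.mem_filter.1 hs₁A).2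
    -- termwise geometric bound anchored at the first index
    have hterm : ∀ s ∈ A, L / d.N s ≤ (1 / 8 : ℝ) ^ (s - s₁) := by
      intro s hs
      have hle : s₁ ≤ s := Finset.min'_le A s hs
      have h1 := d.N_div_N_le hle
      have h2 : L / d.N s ≤ d.N s₁ / d.N s := div_le_div_of_nonneg_right hL₁ (d.N_pos s).le
      exact h2.trans h1
    calc ∑ s ∈ A, L / d.N s ≤ ∑ s ∈ A, (1 / 8 : ℝ) ^ (s - s₁) := Finset.sum_le_sum hterm
      _ = ∑ k ∈ A.image (fun s => s - s₁), (1 / 8 : ℝ) ^ k := by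
          rw [Finset.sum_image]
          intro s hs s' hs' h
          have := Finset.min'_le A s hs
          have := Finset.min'_le A s' hs'
          simp only at h
          omega
      _ ≤ ∑ k ∈ Finset.range d.r, (1 / 8 : ℝ) ^ k := by
          apply Finset.sum_le_sum_of_subset_of_nonneg
          · intro k hk
            obtain ⟨s, hs, rfl⟩ := Finset.mem_image.1 hk
            have := (Finset.mem_filter.1 hs).1
            simp only [Finset.mem_range] at this ⊢
            omega
          · intro k _ _; positivity
      _ ≤ 8 / 7 := geom_sum_eighth_le _

/-- **Second lacunary sum**: `∑_{s < r, N_s < L} N_s/L ≤ 8/7` for `L > 0`. [cite: BourgainPavlovic2008, §3.1] -/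
theorem lacunary_sum_lt (L : ℝ) (hL : 0 < L) :
    ∑ s ∈ Finset.range d.r, (if d.N s < L then d.N s / L else 0) ≤ 8 / 7 := by
  classical
  set B := (Finset.range d.r).filter (fun s => d.N s < L) with hB
  rw [← Finset.sum_filter]
  change ∑ s ∈ B, d.N s / L ≤ 8 / 7
  rcases B.eq_empty_or_nonempty with hE | hne
  · rw [hE, Finset.sum_empty]; norm_num
  · set s₀ := B.max' hne
    have hs₀B : s₀ ∈ B := Finset.max'_mem B hne
    have hL₀ : d.N s₀ < L := (Finset.mem_filter.1 hs₀B).2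
    rw [← Finset.sum_div, div_le_iff₀ hL]
    calc ∑ s ∈ B, d.N s ≤ ∑ s ∈ Finset.range (s₀ + 1), d.N s := by
          apply Finset.sum_le_sum_of_subset_of_nonneg
          · intro s hs
            have := Finset.le_max' B s hs
            simp only [Finset.mem_range]; omega
          · intro s _ _; exact (d.N_pos s).le
      _ ≤ 8 / 7 * d.N s₀ := d.sum_N_le s₀
      _ ≤ 8 / 7 * L := by linarith

/-- The sum of the inverse scales: `∑_{s<r} 1/N_s ≤ (8/7)/N_0`. [folklore] -/
theorem sum_inv_N_le : ∑ s ∈ Finset.range d.r, 1 / d.N s ≤ 8 / 7 / d.N 0 := by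
  have h := d.lacunary_sum_ge (d.N 0)
  have h0 := d.N_pos 0
  have heq : ∀ s ∈ Finset.range d.r, (if d.N 0 ≤ d.N s then d.N 0 / d.N s else 0) = d.N 0 * (1 / d.N s) := by
    intro s _
    rw [if_pos (d.N_mono (Nat.zero_le s))]; ring
  rw [Finset.sum_congr rfl heq, ← Finset.mul_sum] at h
  rw [le_div_iff₀ h0]; linarith

/-- The partial sums of the scales up to `s` (within `range r`) are `≤ (8/7) N_s`. [folklore] -/
theorem sum_N_filter_le (s : ℕ) :
    ∑ s' ∈ (Finset.range d.r).filter (fun s' => s' ≤ s), d.N s' ≤ 8 / 7 * d.N s := by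
  calc ∑ s' ∈ (Finset.range d.r).filter (fun s' => s' ≤ s), d.N s'
      ≤ ∑ s' ∈ Finset.range (s + 1), d.N s' := by
        apply Finset.sum_le_sum_of_subset_of_nonneg
        · intro s' hs'
          simp only [Finset.mem_filter, Finset.mem_range] at hs' ⊢; omega
        · intro s' _ _; exact (d.N_pos s').le
    _ ≤ 8 / 7 * d.N s := d.sum_N_le s

/-- **The almost-orthogonality of the scales in time**:
`∑_{s' < r} N_s N_{s'}/(N_s² + N_{s'}²) ≤ 11/14` (the diagonal gives `1/2`, the rest two geometric
series of ratio `1/8`). [folklore] -/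
theorem lacunary_pair_sum_le (s : ℕ) :
    ∑ s' ∈ Finset.range d.r, d.N s * d.N s' / (d.N s ^ 2 + d.N s' ^ 2) ≤ 11 / 14 := by
  classical
  have hNs := d.N_pos s
  -- termwise: diagonal `1/2`, off-diagonal `(1/8)^{|s-s'|}`
  have hterm : ∀ s', d.N s * d.N s' / (d.N s ^ 2 + d.N s' ^ 2) ≤
      (if s' = s then 1 / 2 else 0) + (if s' < s then (1 / 8 : ℝ) ^ (s - s') else 0) +
        (if s < s' then (1 / 8 : ℝ) ^ (s' - s) else 0) := by
    intro s'
    have hNs' := d.N_pos s'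
    have hden : 0 < d.N s ^ 2 + d.N s' ^ 2 := by positivity
    rcases lt_trichotomy s' s with hlt | rfl | hgt
    · rw [if_neg hlt.ne, if_pos hlt, if_neg (not_lt.2 hlt.le), zero_add, add_zero]
      have h1 := d.N_div_N_le hlt.le
      calc d.N s * d.N s' / (d.N s ^ 2 + d.N s' ^ 2) ≤ d.N s' / d.N s := by
            rw [div_le_div_iff₀ hden hNs]; nlinarith
        _ ≤ _ := h1
    · simp only [↓reduceIte, lt_self_iff_false, add_zero]
      rw [div_le_iff₀ hden]; nlinarith
    · rw [if_neg hgt.ne', if_neg (not_lt.2 hgt.le), if_pos hgt, zero_add, zero_add]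
      have h1 := d.N_div_N_le hgt.le
      calc d.N s * d.N s' / (d.N s ^ 2 + d.N s' ^ 2) ≤ d.N s / d.N s' := by
            rw [div_le_div_iff₀ hden hNs']; nlinarith
        _ ≤ _ := h1
  refine (Finset.sum_le_sum fun s' _ => hterm s').trans ?_
  rw [Finset.sum_add_distrib, Finset.sum_add_distrib]
  -- the three pieces
  have hdiag : ∑ s' ∈ Finset.range d.r, (if s' = s then (1 / 2 : ℝ) else 0) ≤ 1 / 2 := by
    rw [Finset.sum_ite_eq']
    split_ifs <;> norm_num
  have hbelow : ∑ s' ∈ Finset.range d.r, (if s' < s then (1 / 8 : ℝ) ^ (s - s') else 0) ≤ 1 / 7 := by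
    rw [← Finset.sum_filter]
    calc ∑ s' ∈ (Finset.range d.r).filter (fun s' => s' < s), (1 / 8 : ℝ) ^ (s - s')
        = ∑ k ∈ ((Finset.range d.r).filter (fun s' => s' < s)).image (fun s' => s - s'), (1 / 8 : ℝ) ^ k := by
          rw [Finset.sum_image]
          intro a ha b hb h
          simp only [Finset.coe_filter, Finset.mem_range, Set.mem_setOf_eq] at ha hb
          beta_reduce at h
          omega
      _ ≤ ∑ k ∈ (Finset.range (s + 1)).filter (fun k => 1 ≤ k), (1 / 8 : ℝ) ^ k := by
          apply Finset.sum_le_sum_of_subset_of_nonneg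
          · intro k hk
            obtain ⟨s', hs', rfl⟩ := Finset.mem_image.1 hk
            simp only [Finset.mem_filter, Finset.mem_range] at hs' ⊢
            omega
          · intro k _ _; positivity
      _ ≤ 1 / 7 := geom_sum_eighth_le' _
  have habove : ∑ s' ∈ Finset.range d.r, (if s < s' then (1 / 8 : ℝ) ^ (s' - s) else 0) ≤ 1 / 7 := by
    rw [← Finset.sum_filter]
    calc ∑ s' ∈ (Finset.range d.r).filter (fun s' => s < s'), (1 / 8 : ℝ) ^ (s' - s)
        = ∑ k ∈ ((Finset.range d.r).filter (fun s' => s < s')).image (fun s' => s' - s), (1 / 8 : ℝ) ^ k := by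
          rw [Finset.sum_image]
          intro a ha b hb h
          simp only [Finset.coe_filter, Finset.mem_range, Set.mem_setOf_eq] at ha hb
          beta_reduce at h
          omega
      _ ≤ ∑ k ∈ (Finset.range (d.r + 1)).filter (fun k => 1 ≤ k), (1 / 8 : ℝ) ^ k := by
          apply Finset.sum_le_sum_of_subset_of_nonneg
          · intro k hk
            obtain ⟨s', hs', rfl⟩ := Finset.mem_image.1 hk
            simp only [Finset.mem_filter, Finset.mem_range] at hs' ⊢
            omega
          · intro k _ _; positivity
      _ ≤ 1 / 7 := geom_sum_eighth_le' _
  linarith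

/-- **The orientation trick** for sums over pairs of scales of a quantity depending on
`(N_min, N_max)` through `x · h(y)`: `∑_{s,s'} N_min h(N_max) ≤ (16/7) ∑_s N_s h(N_s)` for
`h ≥ 0`. [folklore] -/
theorem pair_sum_min_max_le (h : ℝ → ℝ) (hh : ∀ s, 0 ≤ h (d.N s)) :
    ∑ s ∈ Finset.range d.r, ∑ s' ∈ Finset.range d.r,
        min (d.N s) (d.N s') * h (max (d.N s) (d.N s')) ≤
      16 / 7 * ∑ s ∈ Finset.range d.r, d.N s * h (d.N s) := by
  classical
  -- `F(s,s') ≤ G(s,s') + G(s',s)` with `G(s,s') = [s' ≤ s] N_{s'} h(N_s)`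
  set G : ℕ → ℕ → ℝ := fun s s' => if s' ≤ s then d.N s' * h (d.N s) else 0 with hG
  have hF : ∀ s s', min (d.N s) (d.N s') * h (max (d.N s) (d.N s')) ≤ G s s' + G s' s := by
    intro s s'
    simp only [hG]
    rcases le_or_gt s' s with hle | hlt
    · have hN : d.N s' ≤ d.N s := d.N_mono hle
      rw [min_eq_right hN, max_eq_left hN, if_pos hle]
      split_ifs with h2
      · have : s = s' := le_antisymm h2 hle
        subst this
        nlinarith [hh s, d.N_pos s]
      · linarith
    · have hN : d.N s ≤ d.N s' := d.N_mono hlt.le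
      rw [min_eq_left hN, max_eq_right hN, if_neg (not_le.2 hlt), if_pos hlt.le]
      linarith
  have hGsum : ∀ s ∈ Finset.range d.r, ∑ s' ∈ Finset.range d.r, G s s' ≤ 8 / 7 * (d.N s * h (d.N s)) := by
    intro s _
    simp only [hG]
    rw [← Finset.sum_filter]
    have : ∑ s' ∈ (Finset.range d.r).filter (fun s' => s' ≤ s), d.N s' * h (d.N s) =
        (∑ s' ∈ (Finset.range d.r).filter (fun s' => s' ≤ s), d.N s') * h (d.N s) := by
      rw [Finset.sum_mul]
    rw [this]
    have := d.sum_N_filter_le s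
    nlinarith [hh s]
  calc ∑ s ∈ Finset.range d.r, ∑ s' ∈ Finset.range d.r, min (d.N s) (d.N s') * h (max (d.N s) (d.N s'))
      ≤ ∑ s ∈ Finset.range d.r, ∑ s' ∈ Finset.range d.r, (G s s' + G s' s) :=
        Finset.sum_le_sum fun s _ => Finset.sum_le_sum fun s' _ => hF s s'
    _ = ∑ s ∈ Finset.range d.r, ∑ s' ∈ Finset.range d.r, G s s' +
          ∑ s ∈ Finset.range d.r, ∑ s' ∈ Finset.range d.r, G s' s := by
        rw [← Finset.sum_add_distrib]
        refine Finset.sum_congr rfl fun s _ => Finset.sum_add_distrib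
    _ = 2 * ∑ s ∈ Finset.range d.r, ∑ s' ∈ Finset.range d.r, G s s' := by
        rw [Finset.sum_comm (f := fun s s' => G s' s), two_mul]
    _ ≤ 2 * ∑ s ∈ Finset.range d.r, 8 / 7 * (d.N s * h (d.N s)) := by
        gcongr with s hs
        exact hGsum s hs
    _ = 16 / 7 * ∑ s ∈ Finset.range d.r, d.N s * h (d.N s) := by
        rw [← Finset.mul_sum]; ring

/-! ### Sums over the bump indices -/

/-- Sums over the `4r` bump indices of a function of the scale. [folklore] -/
theorem sum_idx {M : Type*} [AddCommMonoid M] (g : ℕ → M) :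
    ∑ a ∈ d.idx, g a.1 = 4 • ∑ s ∈ Finset.range d.r, g s := by
  rw [idx, Finset.sum_product, Finset.smul_sum]
  refine Finset.sum_congr rfl fun s _ => ?_
  dsimp only
  rw [Finset.sum_const, Finset.card_product, Finset.card_univ, Fintype.card_bool]

/-- Sums over ordered pairs of bump indices of a function of the two scales. [folklore] -/
theorem sum_idx_idx {M : Type*} [AddCommMonoid M] (g : ℕ → ℕ → M) :
    ∑ p ∈ d.idx ×ˢ d.idx, g p.1.1 p.2.1 = 16 • ∑ s ∈ Finset.range d.r, ∑ s' ∈ Finset.range d.r, g s s' := by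
  rw [Finset.sum_product]
  have h1 : ∀ a ∈ d.idx, ∑ b ∈ d.idx, g a.1 b.1 = 4 • ∑ s' ∈ Finset.range d.r, g a.1 s' :=
    fun a _ => d.sum_idx (g a.1)
  rw [Finset.sum_congr rfl h1, ← Finset.smul_sum, d.sum_idx (fun s => ∑ s' ∈ Finset.range d.r, g s s'),
    smul_smul]
  norm_num

/-- The low ordered pairs of bump indices. [folklore] -/
def lowPairs : Finset ((ℕ × Bool × Bool) × (ℕ × Bool × Bool)) :=
  (d.idx ×ˢ d.idx).filter (fun p => IsLowPair p.1 p.2)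

/-- The high ordered pairs of bump indices. [folklore] -/
def highPairs : Finset ((ℕ × Bool × Bool) × (ℕ × Bool × Bool)) :=
  (d.idx ×ˢ d.idx).filter (fun p => ¬IsLowPair p.1 p.2)

/-- **There are `8r` low ordered pairs** (same scale, opposite signs, any types). [folklore] -/
theorem card_lowPairs : (d.lowPairs).card = 8 * d.r := by
  classical
  rw [lowPairs, Finset.card_filter, Finset.sum_product]
  have hinner : ∀ a ∈ d.idx, ∑ b ∈ d.idx, (if IsLowPair a b then 1 else 0) = 2 := by
    intro a ha
    rw [idx, Finset.sum_product]
    have ha1 : a.1 ∈ Finset.range d.r := by rw [mem_idx] at ha; simpa using ha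
    rw [Finset.sum_eq_single_of_mem a.1 ha1]
    · rcases a with ⟨s, σ, τ⟩
      simp only [IsLowPair, true_and, ne_eq]
      rw [Finset.sum_product, Fintype.sum_bool, Fintype.sum_bool, Fintype.sum_bool]
      cases σ <;> simp
    · intro s' _ hs'
      refine Finset.sum_eq_zero fun u _ => ?_
      rw [if_neg]
      rintro ⟨h1, _⟩
      exact hs' h1.symm
  rw [Finset.sum_congr rfl hinner, Finset.sum_const, smul_eq_mul, idx, Finset.card_product,
    Finset.card_range, Finset.card_product, Finset.card_univ, Fintype.card_bool]
  ring

/-- An `ite` of `ofReal`s is the `ofReal` of the `ite`. [folklore] -/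
theorem ite_ofReal (c : Prop) [Decidable c] (x y : ℝ) :
    (if c then ENNReal.ofReal x else ENNReal.ofReal y) = ENNReal.ofReal (if c then x else y) := by
  split_ifs <;> rfl

/-! ### The budget of the free evolution -/

/-- **The pieces of the free evolution cost `6 α m` on the path norm**:
`∑_a ∫₀ᵀ massL1(Uᶜ_a r) massL1(y r) dr ≤ 6 α m · pathNorm T y` (Bourgain–Pavlović's bounds
(3.15)–(3.21) for the linear terms with coefficient `e^{tΔ}u₀`, whose smallness is the factor
`Q/√r = α`). [cite: BourgainPavlovic2008, (3.15)–(3.21)] -/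
theorem coefficient_budget_free {T : ℝ} {y : ℝ → E3 → Fin 3 → ℂ} (hy : Continuous (uncurry y)) :
    ∑ a ∈ d.idx, ∫⁻ r in Ioc 0 T, massL1 (d.freePieceC a r) * massL1 (y r) ≤
      ENNReal.ofReal (6 * d.α * d.bumpMass) * pathNorm T y := by
  classical
  have hα := d.α_pos.le
  have hm := d.bumpMass_nonneg
  have hπ2 : 0 < π ^ 2 := by positivity
  refine sum_lintegral_massL1_mul_le_of_budget d.idx (fun a _ => d.continuous_freePieceC a) hy
    (A := fun a => d.α * (d.N a.1 + 2) * d.bumpMass) (κ := fun a => 2 * π ^ 2 * d.N a.1 ^ 2)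
    (N := fun a => d.N a.1) (fun a _ => by have := d.N_pos a.1; positivity)
    (fun a _ => by have := d.N_pos a.1; positivity) (fun a _ r hr => ?_) (fun b => ?_) (fun b => ?_)
  · have h := d.massL1_freePieceC_le a r
    rw [max_eq_left hr.1.le] at h
    simpa [mul_comm, mul_left_comm, mul_assoc] using h
  · -- low bands: `∑_{N_s ≥ 2^b} 2^{b+1} α (N_s+2) m/(2π² N_s²) ≤ (5/π²)(8/7) α m`
    set L : ℝ := (2 : ℝ) ^ b with hL
    have hL0 : 0 < L := by positivity
    have hpt : ∀ a ∈ d.idx, (if L ≤ d.N a.1 then ENNReal.ofReal ((2 : ℝ) ^ (b + 1) *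
        (d.α * (d.N a.1 + 2) * d.bumpMass) / (2 * π ^ 2 * d.N a.1 ^ 2)) else 0) ≤
        ENNReal.ofReal ((1.25 * d.α * d.bumpMass / π ^ 2) * (if L ≤ d.N a.1 then L / d.N a.1 else 0)) := by
      intro a _
      have hN := d.eight_le_N a.1
      have hNpos := d.N_pos a.1
      split_ifs with h
      · refine ENNReal.ofReal_le_ofReal ?_
        rw [zpow_add_one₀ (by norm_num : (2 : ℝ) ≠ 0), ← hL]
        rw [show L * 2 * (d.α * (d.N a.1 + 2) * d.bumpMass) / (2 * π ^ 2 * d.N a.1 ^ 2) =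
          (d.α * d.bumpMass / π ^ 2) * ((d.N a.1 + 2) / d.N a.1) * (L / d.N a.1) by
          field_simp]
        have h1 : (d.N a.1 + 2) / d.N a.1 ≤ 1.25 := by rw [div_le_iff₀ hNpos]; linarith
        have h2 : 0 ≤ L / d.N a.1 := by positivity
        have h3 : 0 ≤ d.α * d.bumpMass / π ^ 2 := by positivity
        calc d.α * d.bumpMass / π ^ 2 * ((d.N a.1 + 2) / d.N a.1) * (L / d.N a.1)
            ≤ d.α * d.bumpMass / π ^ 2 * 1.25 * (L / d.N a.1) := by
              apply mul_le_mul_of_nonneg_right _ h2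
              exact mul_le_mul_of_nonneg_left h1 h3
          _ = 1.25 * d.α * d.bumpMass / π ^ 2 * (L / d.N a.1) := by ring
      · simp
    refine (Finset.sum_le_sum hpt).trans ?_
    rw [← ENNReal.ofReal_sum_of_nonneg (fun a _ => mul_nonneg (by positivity) (by
      split_ifs
      · exact div_nonneg hL0.le (d.N_pos _).le
      · rfl))]
    refine ENNReal.ofReal_le_ofReal ?_
    rw [← Finset.mul_sum, d.sum_idx (fun s => if L ≤ d.N s then L / d.N s else 0), nsmul_eq_mul]
    have hlac := d.lacunary_sum_ge L
    have hπ : π ^ 2 ≥ 9 := by nlinarith [Real.pi_gt_three]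
    have : 1.25 * d.α * d.bumpMass / π ^ 2 ≤ 1.25 * d.α * d.bumpMass / 9 :=
      div_le_div_of_nonneg_left (by positivity) (by norm_num) hπ
    push_cast
    have h0 : 0 ≤ ∑ s ∈ Finset.range d.r, (if L ≤ d.N s then L / d.N s else 0) :=
      Finset.sum_nonneg fun s _ => by
        split_ifs
        · exact div_nonneg hL0.le (d.N_pos s).le
        · rfl
    nlinarith [mul_nonneg hα hm]
  · -- high bands: `∑_{N_s < 2^b} 2^{-b} α (N_s + 2) m ≤ 5 (8/7) α m`
    set L : ℝ := (2 : ℝ) ^ b with hL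
    have hL0 : 0 < L := by positivity
    have hpt : ∀ a ∈ d.idx, (if L ≤ d.N a.1 then 0 else
        ENNReal.ofReal ((2 : ℝ) ^ (-b) * (d.α * (d.N a.1 + 2) * d.bumpMass))) ≤
        ENNReal.ofReal ((1.25 * d.α * d.bumpMass) * (if d.N a.1 < L then d.N a.1 / L else 0)) := by
      intro a _
      have hN := d.eight_le_N a.1
      have hNpos := d.N_pos a.1
      by_cases hc : L ≤ d.N a.1
      · rw [if_pos hc, if_neg (not_lt.2 hc)]; simp
      · rw [if_neg hc, if_pos (not_le.1 hc)]
        refine ENNReal.ofReal_le_ofReal ?_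
        rw [zpow_neg, ← hL, ← one_div]
        rw [show 1 / L * (d.α * (d.N a.1 + 2) * d.bumpMass) = (d.α * d.bumpMass) * ((d.N a.1 + 2) / L) by
          field_simp]
        have h1 : (d.N a.1 + 2) / L ≤ 1.25 * (d.N a.1 / L) := by
          rw [mul_div_assoc', div_le_div_iff_of_pos_right hL0]; linarith
        nlinarith [mul_nonneg hα hm, div_nonneg hNpos.le hL0.le]
    refine (Finset.sum_le_sum hpt).trans ?_
    rw [← ENNReal.ofReal_sum_of_nonneg (fun a _ => mul_nonneg (by positivity) (by
      split_ifs
      · exact div_nonneg (d.N_pos _).le hL0.le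
      · rfl))]
    refine ENNReal.ofReal_le_ofReal ?_
    rw [← Finset.mul_sum, d.sum_idx (fun s => if d.N s < L then d.N s / L else 0), nsmul_eq_mul]
    have hlac := d.lacunary_sum_lt L hL0
    push_cast
    have h0 : 0 ≤ ∑ s ∈ Finset.range d.r, (if d.N s < L then d.N s / L else 0) :=
      Finset.sum_nonneg fun s _ => by
        split_ifs
        · exact div_nonneg (d.N_pos s).le hL0.le
        · rfl
    nlinarith [mul_nonneg hα hm]

/-! ### The budget of the high pair interactions -/

/-- **The high pair interactions of `u₁` cost `2000 α² m²` on the path norm**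
(Bourgain–Pavlović's (3.26)–(3.37): the linear terms with coefficient `u₁` off the low mode;
the smallness is `α² = Q²/r`). [cite: BourgainPavlovic2008, (3.26)–(3.37)] -/
theorem coefficient_budget_pairs_high {T : ℝ} {y : ℝ → E3 → Fin 3 → ℂ} (hy : Continuous (uncurry y)) :
    ∑ p ∈ d.highPairs, ∫⁻ r in Ioc 0 T, massL1 (d.pairTerm p.1 p.2 r) * massL1 (y r) ≤
      ENNReal.ofReal (2000 * d.α ^ 2 * d.bumpMass ^ 2) * pathNorm T y := by
  classical
  have hα := d.α_pos.le
  have hm := d.bumpMass_nonneg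
  have hπ2 : 0 < π ^ 2 := by positivity
  have hπ9 : (9 : ℝ) ≤ π ^ 2 := by nlinarith [Real.pi_gt_three]
  set C : ℝ := d.α ^ 2 * d.bumpMass ^ 2 with hC
  have hC0 : 0 ≤ C := by positivity
  refine sum_lintegral_massL1_mul_le_of_budget d.highPairs (fun p _ => d.continuous_pairTerm p.1 p.2) hy
    (A := fun p => 45 * d.α ^ 2 * d.bumpMass ^ 2 * min (d.N p.1.1) (d.N p.2.1))
    (κ := fun p => π ^ 2 * max (d.N p.1.1) (d.N p.2.1) ^ 2)
    (N := fun p => max (d.N p.1.1) (d.N p.2.1))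
    (fun p _ => by have := d.N_pos p.1.1; have := d.N_pos p.2.1; positivity)
    (fun p _ => by have := d.N_pos p.1.1; have := d.N_pos p.2.1; positivity)
    (fun p hp r hr => ?_) (fun b => ?_) (fun b => ?_)
  · have hnl : ¬IsLowPair p.1 p.2 := (Finset.mem_filter.1 hp).2
    have h := d.massL1_pairTerm_le_of_not_low hnl hr.1.le
    simpa [mul_comm, mul_left_comm, mul_assoc] using h
  · -- low bands
    set L : ℝ := (2 : ℝ) ^ b with hL
    have hL0 : 0 < L := by positivity
    -- the summand as `min · h(max)` with `h y = [L ≤ y] (90 C/π²) L/y²`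
    set h : ℝ → ℝ := fun yv => if L ≤ yv then (90 * C / π ^ 2) * L / yv ^ 2 else 0 with hh
    have hh0 : ∀ s, 0 ≤ h (d.N s) := fun s => by
      simp only [hh]
      split_ifs
      · have := d.N_pos s; positivity
      · rfl
    have hpt : ∀ p ∈ d.highPairs, (if L ≤ max (d.N p.1.1) (d.N p.2.1) then
        ENNReal.ofReal ((2 : ℝ) ^ (b + 1) * (45 * d.α ^ 2 * d.bumpMass ^ 2 * min (d.N p.1.1) (d.N p.2.1)) /
          (π ^ 2 * max (d.N p.1.1) (d.N p.2.1) ^ 2)) else 0) ≤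
        ENNReal.ofReal (min (d.N p.1.1) (d.N p.2.1) * h (max (d.N p.1.1) (d.N p.2.1))) := by
      intro p _
      simp only [hh]
      split_ifs with hc
      · refine ENNReal.ofReal_le_ofReal (le_of_eq ?_)
        rw [zpow_add_one₀ (by norm_num : (2 : ℝ) ≠ 0), ← hL, hC]
        have := d.N_pos p.1.1; have := d.N_pos p.2.1
        field_simp
        ring
      · simp
    calc ∑ p ∈ d.highPairs, (if L ≤ max (d.N p.1.1) (d.N p.2.1) then
          ENNReal.ofReal ((2 : ℝ) ^ (b + 1) * (45 * d.α ^ 2 * d.bumpMass ^ 2 * min (d.N p.1.1) (d.N p.2.1)) /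
            (π ^ 2 * max (d.N p.1.1) (d.N p.2.1) ^ 2)) else 0)
        ≤ ∑ p ∈ d.highPairs, ENNReal.ofReal (min (d.N p.1.1) (d.N p.2.1) * h (max (d.N p.1.1) (d.N p.2.1))) :=
          Finset.sum_le_sum hpt
      _ ≤ ∑ p ∈ d.idx ×ˢ d.idx, ENNReal.ofReal (min (d.N p.1.1) (d.N p.2.1) * h (max (d.N p.1.1) (d.N p.2.1))) :=
          Finset.sum_le_sum_of_subset (Finset.filter_subset _ _)
      _ = ENNReal.ofReal (16 * ∑ s ∈ Finset.range d.r, ∑ s' ∈ Finset.range d.r,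
            min (d.N s) (d.N s') * h (max (d.N s) (d.N s'))) := by
          rw [← ENNReal.ofReal_sum_of_nonneg (fun p _ => mul_nonneg (le_min (d.N_pos _).le (d.N_pos _).le)
            (by rcases max_cases (d.N p.1.1) (d.N p.2.1) with ⟨h1, _⟩ | ⟨h1, _⟩ <;> rw [h1] <;> exact hh0 _)),
            d.sum_idx_idx (fun s s' => min (d.N s) (d.N s') * h (max (d.N s) (d.N s'))), nsmul_eq_mul]
          norm_num
      _ ≤ ENNReal.ofReal (2000 * d.α ^ 2 * d.bumpMass ^ 2) := by
          refine ENNReal.ofReal_le_ofReal ?_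
          have h1 := d.pair_sum_min_max_le h hh0
          have h2 : ∑ s ∈ Finset.range d.r, d.N s * h (d.N s) =
              (90 * C / π ^ 2) * ∑ s ∈ Finset.range d.r, (if L ≤ d.N s then L / d.N s else 0) := by
            rw [Finset.mul_sum]
            refine Finset.sum_congr rfl fun s _ => ?_
            simp only [hh]
            have := d.N_pos s
            split_ifs
            · field_simp
            · ring
          have h3 := d.lacunary_sum_ge L
          have h4 : 90 * C / π ^ 2 ≤ 90 * C / 9 := div_le_div_of_nonneg_left (by positivity) (by norm_num) hπ9
          have h5 : 0 ≤ ∑ s ∈ Finset.range d.r, (if L ≤ d.N s then L / d.N s else 0) :=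
            Finset.sum_nonneg fun s _ => by
              split_ifs
              · exact div_nonneg hL0.le (d.N_pos s).le
              · rfl
          rw [h2] at h1
          rw [hC] at h4 h1
          nlinarith [mul_nonneg (mul_nonneg (by norm_num : (0:ℝ) ≤ 90) hC0) h5]
  · -- high bands
    set L : ℝ := (2 : ℝ) ^ b with hL
    have hL0 : 0 < L := by positivity
    set h : ℝ → ℝ := fun yv => if L ≤ yv then 0 else 45 * C / L with hh
    have hh0 : ∀ s, 0 ≤ h (d.N s) := fun s => by
      simp only [hh]
      split_ifs
      · rfl
      · positivity
    have hpt : ∀ p ∈ d.highPairs, (if L ≤ max (d.N p.1.1) (d.N p.2.1) then 0 else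
        ENNReal.ofReal ((2 : ℝ) ^ (-b) * (45 * d.α ^ 2 * d.bumpMass ^ 2 * min (d.N p.1.1) (d.N p.2.1)))) ≤
        ENNReal.ofReal (min (d.N p.1.1) (d.N p.2.1) * h (max (d.N p.1.1) (d.N p.2.1))) := by
      intro p _
      simp only [hh]
      split_ifs with hc
      · simp
      · refine ENNReal.ofReal_le_ofReal (le_of_eq ?_)
        rw [zpow_neg, ← hL, hC]
        field_simp
    calc ∑ p ∈ d.highPairs, (if L ≤ max (d.N p.1.1) (d.N p.2.1) then 0 else
          ENNReal.ofReal ((2 : ℝ) ^ (-b) * (45 * d.α ^ 2 * d.bumpMass ^ 2 * min (d.N p.1.1) (d.N p.2.1))))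
        ≤ ∑ p ∈ d.highPairs, ENNReal.ofReal (min (d.N p.1.1) (d.N p.2.1) * h (max (d.N p.1.1) (d.N p.2.1))) :=
          Finset.sum_le_sum hpt
      _ ≤ ∑ p ∈ d.idx ×ˢ d.idx, ENNReal.ofReal (min (d.N p.1.1) (d.N p.2.1) * h (max (d.N p.1.1) (d.N p.2.1))) :=
          Finset.sum_le_sum_of_subset (Finset.filter_subset _ _)
      _ = ENNReal.ofReal (16 * ∑ s ∈ Finset.range d.r, ∑ s' ∈ Finset.range d.r,
            min (d.N s) (d.N s') * h (max (d.N s) (d.N s'))) := by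
          rw [← ENNReal.ofReal_sum_of_nonneg (fun p _ => mul_nonneg (le_min (d.N_pos _).le (d.N_pos _).le)
            (by rcases max_cases (d.N p.1.1) (d.N p.2.1) with ⟨h1, _⟩ | ⟨h1, _⟩ <;> rw [h1] <;> exact hh0 _)),
            d.sum_idx_idx (fun s s' => min (d.N s) (d.N s') * h (max (d.N s) (d.N s'))), nsmul_eq_mul]
          norm_num
      _ ≤ ENNReal.ofReal (2000 * d.α ^ 2 * d.bumpMass ^ 2) := by
          refine ENNReal.ofReal_le_ofReal ?_
          have h1 := d.pair_sum_min_max_le h hh0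
          have h2 : ∑ s ∈ Finset.range d.r, d.N s * h (d.N s) =
              (45 * C) * ∑ s ∈ Finset.range d.r, (if d.N s < L then d.N s / L else 0) := by
            rw [Finset.mul_sum]
            refine Finset.sum_congr rfl fun s _ => ?_
            simp only [hh]
            by_cases hc : L ≤ d.N s
            · rw [if_pos hc, if_neg (not_lt.2 hc)]; ring
            · rw [if_neg hc, if_pos (not_le.1 hc)]
              have := d.N_pos s
              field_simp
          have h3 := d.lacunary_sum_lt L hL0
          have h5 : 0 ≤ ∑ s ∈ Finset.range d.r, (if d.N s < L then d.N s / L else 0) :=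
            Finset.sum_nonneg fun s _ => by
              split_ifs
              · exact div_nonneg (d.N_pos s).le hL0.le
              · rfl
          rw [h2] at h1
          rw [hC] at h1
          nlinarith [mul_nonneg (mul_nonneg (by norm_num : (0:ℝ) ≤ 45) hC0) h5]

/-! ### The budget of the low pair interactions -/

/-- **The low pair interactions of `u₁` cost `48 α² r m² √T` on the path norm** (the low mode of
`u₁`, of size `∼ Q² = α² r` uniformly in time, against the short time interval: Bourgain–Pavlović's
(3.25)). [cite: BourgainPavlovic2008, (3.25)] -/
theorem coefficient_budget_pairs_low {T : ℝ} (hT : 0 ≤ T) {y : ℝ → E3 → Fin 3 → ℂ}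
    (hy : Continuous (uncurry y)) :
    ∑ p ∈ d.lowPairs, ∫⁻ r in Ioc 0 T, massL1 (d.pairTerm p.1 p.2 r) * massL1 (y r) ≤
      ENNReal.ofReal (48 * d.α ^ 2 * d.r * d.bumpMass ^ 2 * Real.sqrt T) * pathNorm T y := by
  classical
  have hα := d.α_pos.le
  have hm := d.bumpMass_nonneg
  have hpt : ∀ p ∈ d.lowPairs, ∫⁻ r in Ioc 0 T, massL1 (d.pairTerm p.1 p.2 r) * massL1 (y r) ≤
      ENNReal.ofReal (6 * d.α ^ 2 * d.bumpMass ^ 2) * ENNReal.ofReal (Real.sqrt T) * pathNorm T y := by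
    intro p hp
    have hl : IsLowPair p.1 p.2 := (Finset.mem_filter.1 hp).2
    exact lintegral_massL1_mul_massL1_le_sqrt hT hy fun r hr => d.massL1_pairTerm_le_of_low hl hr.1.le
  calc ∑ p ∈ d.lowPairs, ∫⁻ r in Ioc 0 T, massL1 (d.pairTerm p.1 p.2 r) * massL1 (y r)
      ≤ ∑ p ∈ d.lowPairs, ENNReal.ofReal (6 * d.α ^ 2 * d.bumpMass ^ 2) * ENNReal.ofReal (Real.sqrt T) *
          pathNorm T y := Finset.sum_le_sum hpt
    _ = (8 * d.r : ℕ) * (ENNReal.ofReal (6 * d.α ^ 2 * d.bumpMass ^ 2) * ENNReal.ofReal (Real.sqrt T) *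
          pathNorm T y) := by
        rw [Finset.sum_const, card_lowPairs, nsmul_eq_mul]
    _ = ENNReal.ofReal (48 * d.α ^ 2 * d.r * d.bumpMass ^ 2 * Real.sqrt T) * pathNorm T y := by
        rw [← mul_assoc, ← mul_assoc]
        congr 1
        rw [show ((8 * d.r : ℕ) : ℝ≥0∞) = ENNReal.ofReal (8 * d.r) by
          rw [(ENNReal.ofReal_natCast (8 * d.r)).symm]; push_cast; ring_nf]
        rw [← ENNReal.ofReal_mul (by positivity), ← ENNReal.ofReal_mul (by positivity)]
        congr 1; ring

/-! ### The sizes of the forcing terms -/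

/-- `∫⁻_{(0,T]} (A e^{-κ r})(B e^{-κ' r}) dr ≤ A B/(κ + κ')`. [folklore] -/
theorem lintegral_Ioc_expProd_le {A B κ κ' : ℝ} (hA : 0 ≤ A) (hB : 0 ≤ B) (hκ : 0 < κ + κ') (T : ℝ) :
    ∫⁻ r in Ioc 0 T, ENNReal.ofReal (A * Real.exp (-κ * r)) * ENNReal.ofReal (B * Real.exp (-κ' * r)) ≤
      ENNReal.ofReal (A * B / (κ + κ')) := by
  have heq : ∀ r, ENNReal.ofReal (A * Real.exp (-κ * r)) * ENNReal.ofReal (B * Real.exp (-κ' * r)) =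
      ENNReal.ofReal (A * B) * ENNReal.ofReal (Real.exp (-(κ + κ') * r)) := fun r => by
    rw [← ENNReal.ofReal_mul (by positivity), ← ENNReal.ofReal_mul (by positivity)]
    congr 1
    rw [show -(κ + κ') * r = -κ * r + -κ' * r by ring, Real.exp_add]; ring
  simp_rw [heq]
  rw [lintegral_const_mul' _ _ ENNReal.ofReal_ne_top]
  calc ENNReal.ofReal (A * B) * ∫⁻ r in Ioc 0 T, ENNReal.ofReal (Real.exp (-(κ + κ') * r))
      ≤ ENNReal.ofReal (A * B) * ENNReal.ofReal (1 / (κ + κ')) :=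
        mul_le_mul' le_rfl (lintegral_Ioc_exp_neg_le hκ T)
    _ = ENNReal.ofReal (A * B / (κ + κ')) := by
        rw [← ENNReal.ofReal_mul (by positivity)]; congr 1; ring

/-- The mass of the clamped free evolution is at most the sum of the masses of its pieces. [folklore] -/
theorem massL1_freeC_le (r : ℝ) : massL1 (d.freeC r) ≤ ∑ a ∈ d.idx, massL1 (d.freePieceC a r) := by
  rw [massL1_eq, d.freeC_eq_sum_fun r]
  calc ∫⁻ ξ, ‖∑ a ∈ d.idx, d.freePieceC a r ξ‖ₑ ≤ ∫⁻ ξ, ∑ a ∈ d.idx, ‖d.freePieceC a r ξ‖ₑ :=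
        lintegral_mono fun ξ => enorm_sum_le _ _
    _ = ∑ a ∈ d.idx, massL1 (d.freePieceC a r) := by
        rw [lintegral_finsetSum' _ fun a _ =>
          ((d.continuous_freePieceC a).uncurry_left r).aestronglyMeasurable.enorm]
        rfl

/-- **The high mass** of the second iterate: `H(r) = ∑_{high pairs} massL1 (pairTerm a b r)`. [folklore] -/
def highMass (r : ℝ) : ℝ≥0∞ := ∑ p ∈ d.highPairs, massL1 (d.pairTerm p.1 p.2 r)

/-- `H` is measurable in time. [folklore] -/
theorem measurable_highMass : Measurable d.highMass := by
  unfold highMass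
  exact Finset.measurable_sum _ fun p _ => measurable_massL1 (d.continuous_pairTerm p.1 p.2)

/-- **The mass of the second iterate**: `massL1 (u₁ r) ≤ 48 α² r m² + H(r)` for `r ≥ 0` (the `8r`
low pairs of mass `≤ 6α²m²` each, plus the high pairs). [cite: BourgainPavlovic2008, (3.7)–(3.12)] -/
theorem massL1_secondIterate_le {r : ℝ} (hr : 0 ≤ r) :
    massL1 (d.secondIterate r) ≤ ENNReal.ofReal (48 * d.α ^ 2 * d.r * d.bumpMass ^ 2) + d.highMass r := by
  classical
  have hsum : massL1 (d.secondIterate r) ≤ ∑ p ∈ d.idx ×ˢ d.idx, massL1 (d.pairTerm p.1 p.2 r) := by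
    rw [massL1_eq]
    have hpt : ∀ ξ, ‖d.secondIterate r ξ‖ₑ ≤ ∑ p ∈ d.idx ×ˢ d.idx, ‖d.pairTerm p.1 p.2 r ξ‖ₑ := by
      intro ξ
      rw [d.secondIterate_eq_sum r ξ, ← Finset.sum_product']
      exact enorm_sum_le _ _
    calc ∫⁻ ξ, ‖d.secondIterate r ξ‖ₑ ≤ ∫⁻ ξ, ∑ p ∈ d.idx ×ˢ d.idx, ‖d.pairTerm p.1 p.2 r ξ‖ₑ :=
          lintegral_mono hpt
      _ = ∑ p ∈ d.idx ×ˢ d.idx, massL1 (d.pairTerm p.1 p.2 r) := by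
          rw [lintegral_finsetSum' _ fun p _ =>
            ((d.continuous_pairTerm p.1 p.2).uncurry_left r).aestronglyMeasurable.enorm]
          rfl
  refine hsum.trans ?_
  rw [← Finset.sum_filter_add_sum_filter_not (d.idx ×ˢ d.idx) (fun p => IsLowPair p.1 p.2)]
  refine add_le_add ?_ le_rfl
  calc ∑ p ∈ (d.idx ×ˢ d.idx).filter (fun p => IsLowPair p.1 p.2), massL1 (d.pairTerm p.1 p.2 r)
      ≤ ∑ p ∈ (d.idx ×ˢ d.idx).filter (fun p => IsLowPair p.1 p.2), ENNReal.ofReal (6 * d.α ^ 2 * d.bumpMass ^ 2) :=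
        Finset.sum_le_sum fun p hp => d.massL1_pairTerm_le_of_low (Finset.mem_filter.1 hp).2 hr
    _ = ENNReal.ofReal (48 * d.α ^ 2 * d.r * d.bumpMass ^ 2) := by
        rw [Finset.sum_const, show ((d.idx ×ˢ d.idx).filter (fun p => IsLowPair p.1 p.2)) = d.lowPairs from rfl,
          card_lowPairs, nsmul_eq_mul,
          show ((8 * d.r : ℕ) : ℝ≥0∞) = ENNReal.ofReal (8 * d.r) by
            rw [(ENNReal.ofReal_natCast (8 * d.r)).symm]; push_cast; ring_nf,
          ← ENNReal.ofReal_mul (by positivity)]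
        congr 1; ring

/-- **The time integral of the free mass**: `∫₀ᵀ massL1(Uᶜ r) dr ≤ 0.32 α m / N_0`. [folklore] -/
theorem lintegral_massL1_freeC_le (T : ℝ) :
    ∫⁻ r in Ioc 0 T, massL1 (d.freeC r) ≤ ENNReal.ofReal (0.32 * d.α * d.bumpMass / d.N 0) := by
  classical
  have hα := d.α_pos.le
  have hm := d.bumpMass_nonneg
  have hN0 := d.N_pos 0
  have hπ9 : (9 : ℝ) ≤ π ^ 2 := by nlinarith [Real.pi_gt_three]
  calc ∫⁻ r in Ioc 0 T, massL1 (d.freeC r) ≤ ∫⁻ r in Ioc 0 T, ∑ a ∈ d.idx, massL1 (d.freePieceC a r) :=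
        lintegral_mono fun r => d.massL1_freeC_le r
    _ = ∑ a ∈ d.idx, ∫⁻ r in Ioc 0 T, massL1 (d.freePieceC a r) :=
        lintegral_finsetSum' _ fun a _ => (measurable_massL1 (d.continuous_freePieceC a)).aemeasurable
    _ ≤ ∑ a ∈ d.idx, ENNReal.ofReal ((0.625 * d.α * d.bumpMass / π ^ 2) * (1 / d.N a.1)) := by
        refine Finset.sum_le_sum fun a _ => ?_
        have hN := d.eight_le_N a.1
        have hNpos := d.N_pos a.1
        have hκ : 0 < 2 * π ^ 2 * d.N a.1 ^ 2 := by positivity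
        calc ∫⁻ r in Ioc 0 T, massL1 (d.freePieceC a r)
            ≤ ∫⁻ r in Ioc 0 T, ENNReal.ofReal (d.α * (d.N a.1 + 2) * d.bumpMass) *
                ENNReal.ofReal (Real.exp (-(2 * π ^ 2 * d.N a.1 ^ 2) * r)) := by
              refine setLIntegral_mono' measurableSet_Ioc fun r hr => ?_
              have h := d.massL1_freePieceC_le a r
              rw [max_eq_left hr.1.le] at h
              rwa [← ENNReal.ofReal_mul (by positivity)]
          _ ≤ ENNReal.ofReal (d.α * (d.N a.1 + 2) * d.bumpMass) * ENNReal.ofReal (1 / (2 * π ^ 2 * d.N a.1 ^ 2)) := by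
              rw [lintegral_const_mul' _ _ ENNReal.ofReal_ne_top]
              exact mul_le_mul' le_rfl (lintegral_Ioc_exp_neg_le hκ T)
          _ ≤ ENNReal.ofReal ((0.625 * d.α * d.bumpMass / π ^ 2) * (1 / d.N a.1)) := by
              rw [← ENNReal.ofReal_mul (by positivity)]
              refine ENNReal.ofReal_le_ofReal ?_
              rw [show d.α * (d.N a.1 + 2) * d.bumpMass * (1 / (2 * π ^ 2 * d.N a.1 ^ 2)) =
                (d.α * d.bumpMass / π ^ 2) * ((d.N a.1 + 2) / (2 * d.N a.1)) * (1 / d.N a.1) by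
                field_simp]
              have h1 : (d.N a.1 + 2) / (2 * d.N a.1) ≤ 0.625 := by
                rw [div_le_iff₀ (by positivity)]; linarith
              have h2 : 0 ≤ d.α * d.bumpMass / π ^ 2 := by positivity
              have h3 : 0 ≤ 1 / d.N a.1 := by positivity
              calc d.α * d.bumpMass / π ^ 2 * ((d.N a.1 + 2) / (2 * d.N a.1)) * (1 / d.N a.1)
                  ≤ d.α * d.bumpMass / π ^ 2 * 0.625 * (1 / d.N a.1) := by
                    apply mul_le_mul_of_nonneg_right _ h3
                    exact mul_le_mul_of_nonneg_left h1 h2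
                _ = _ := by ring
    _ = ENNReal.ofReal ((0.625 * d.α * d.bumpMass / π ^ 2) * (4 * ∑ s ∈ Finset.range d.r, 1 / d.N s)) := by
        rw [← ENNReal.ofReal_sum_of_nonneg (fun a _ => by have := d.N_pos a.1; positivity), ← Finset.mul_sum,
          d.sum_idx (fun s => 1 / d.N s), nsmul_eq_mul]
        norm_num
    _ ≤ ENNReal.ofReal (0.32 * d.α * d.bumpMass / d.N 0) := by
        refine ENNReal.ofReal_le_ofReal ?_
        have h1 := d.sum_inv_N_le
        have h2 : 0.625 * d.α * d.bumpMass / π ^ 2 ≤ 0.625 * d.α * d.bumpMass / 9 :=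
          div_le_div_of_nonneg_left (by positivity) (by norm_num) hπ9
        have h3 : 0 ≤ ∑ s ∈ Finset.range d.r, 1 / d.N s := Finset.sum_nonneg fun s _ => by
          have := d.N_pos s; positivity
        calc 0.625 * d.α * d.bumpMass / π ^ 2 * (4 * ∑ s ∈ Finset.range d.r, 1 / d.N s)
            ≤ 0.625 * d.α * d.bumpMass / 9 * (4 * (8 / 7 / d.N 0)) := by
              apply mul_le_mul h2 (by linarith) (by positivity) (by positivity)
          _ ≤ 0.32 * d.α * d.bumpMass / d.N 0 := by
              have h4 : 0 ≤ d.α * d.bumpMass / d.N 0 := by positivity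
              rw [show 0.625 * d.α * d.bumpMass / 9 * (4 * (8 / 7 / d.N 0)) = (20 / 63) * (d.α * d.bumpMass / d.N 0) by
                ring, show 0.32 * d.α * d.bumpMass / d.N 0 = 0.32 * (d.α * d.bumpMass / d.N 0) by ring]
              exact mul_le_mul_of_nonneg_right (by norm_num) h4

/-- The lacunary double sum `∑_{s,s''} N_s N_{s''}/(N_s² + N_{s''}²) ≤ (11/14) r`. [folklore] -/
theorem lacunary_double_sum_le :
    ∑ s ∈ Finset.range d.r, ∑ s' ∈ Finset.range d.r, d.N s * d.N s' / (d.N s ^ 2 + d.N s' ^ 2) ≤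
      11 / 14 * d.r := by
  calc ∑ s ∈ Finset.range d.r, ∑ s' ∈ Finset.range d.r, d.N s * d.N s' / (d.N s ^ 2 + d.N s' ^ 2)
      ≤ ∑ _s ∈ Finset.range d.r, (11 / 14 : ℝ) := Finset.sum_le_sum fun s _ => d.lacunary_pair_sum_le s
    _ = 11 / 14 * d.r := by rw [Finset.sum_const, Finset.card_range, nsmul_eq_mul]; ring

/-- **The high mass against the free mass**: `∫₀ᵀ H(r) massL1(Uᶜ r) dr ≤ 656 α³ r m³` (triple
lacunary sum). [cite: BourgainPavlovic2008, §3.3] -/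
theorem lintegral_highMass_mul_freeC_le (T : ℝ) :
    ∫⁻ r in Ioc 0 T, d.highMass r * massL1 (d.freeC r) ≤ ENNReal.ofReal (656 * d.α ^ 3 * d.r * d.bumpMass ^ 3) := by
  classical
  have hα := d.α_pos.le
  have hm := d.bumpMass_nonneg
  have hπ := Real.pi_gt_d2
  have hπ2 : (9.8596 : ℝ) ≤ π ^ 2 := by nlinarith
  set C : ℝ := d.α ^ 3 * d.bumpMass ^ 3 with hC
  have hC0 : 0 ≤ C := by positivity
  -- expand both masses over pairs and pieces
  calc ∫⁻ r in Ioc 0 T, d.highMass r * massL1 (d.freeC r)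
      ≤ ∫⁻ r in Ioc 0 T, ∑ p ∈ d.highPairs, ∑ a ∈ d.idx,
          massL1 (d.pairTerm p.1 p.2 r) * massL1 (d.freePieceC a r) := by
        refine lintegral_mono fun r => ?_
        rw [highMass]
        calc (∑ p ∈ d.highPairs, massL1 (d.pairTerm p.1 p.2 r)) * massL1 (d.freeC r)
            ≤ (∑ p ∈ d.highPairs, massL1 (d.pairTerm p.1 p.2 r)) * ∑ a ∈ d.idx, massL1 (d.freePieceC a r) :=
              mul_le_mul' le_rfl (d.massL1_freeC_le r)
          _ = _ := Finset.sum_mul_sum _ _ _ _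
    _ = ∑ p ∈ d.highPairs, ∫⁻ r in Ioc 0 T, ∑ a ∈ d.idx, massL1 (d.pairTerm p.1 p.2 r) * massL1 (d.freePieceC a r) :=
        lintegral_finsetSum' _ fun p _ => (Finset.measurable_sum _ fun a _ =>
          ((measurable_massL1 (d.continuous_pairTerm p.1 p.2)).mul
            (measurable_massL1 (d.continuous_freePieceC a)))).aemeasurable
    _ = ∑ p ∈ d.highPairs, ∑ a ∈ d.idx, ∫⁻ r in Ioc 0 T, massL1 (d.pairTerm p.1 p.2 r) * massL1 (d.freePieceC a r) :=
        Finset.sum_congr rfl fun p _ => lintegral_finsetSum' _ fun a _ =>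
          ((measurable_massL1 (d.continuous_pairTerm p.1 p.2)).mul
            (measurable_massL1 (d.continuous_freePieceC a))).aemeasurable
    _ ≤ ∑ p ∈ d.highPairs, ∑ a ∈ d.idx, ENNReal.ofReal ((56.25 * C / π ^ 2) *
          (min (d.N p.1.1) (d.N p.2.1) * d.N a.1 / (max (d.N p.1.1) (d.N p.2.1) ^ 2 + d.N a.1 ^ 2))) := by
        refine Finset.sum_le_sum fun p hp => Finset.sum_le_sum fun a _ => ?_
        have hnl : ¬IsLowPair p.1 p.2 := (Finset.mem_filter.1 hp).2
        set Nmin := min (d.N p.1.1) (d.N p.2.1) with hNmin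
        set Nmax := max (d.N p.1.1) (d.N p.2.1) with hNmax
        have hNmin0 : 0 < Nmin := lt_min (d.N_pos _) (d.N_pos _)
        have hNmax8 : 8 ≤ Nmax := le_max_of_le_left (d.eight_le_N _)
        have hNa := d.eight_le_N a.1
        have hNapos := d.N_pos a.1
        calc ∫⁻ r in Ioc 0 T, massL1 (d.pairTerm p.1 p.2 r) * massL1 (d.freePieceC a r)
            ≤ ∫⁻ r in Ioc 0 T, ENNReal.ofReal (45 * d.α ^ 2 * d.bumpMass ^ 2 * Nmin * Real.exp (-(π ^ 2 * Nmax ^ 2) * r)) *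
                ENNReal.ofReal (d.α * (d.N a.1 + 2) * d.bumpMass * Real.exp (-(2 * π ^ 2 * d.N a.1 ^ 2) * r)) := by
              refine setLIntegral_mono' measurableSet_Ioc fun r hr => mul_le_mul' ?_ ?_
              · exact d.massL1_pairTerm_le_of_not_low hnl hr.1.le
              · have h := d.massL1_freePieceC_le a r
                rwa [max_eq_left hr.1.le] at h
            _ ≤ ENNReal.ofReal (45 * d.α ^ 2 * d.bumpMass ^ 2 * Nmin * (d.α * (d.N a.1 + 2) * d.bumpMass) /
                (π ^ 2 * Nmax ^ 2 + 2 * π ^ 2 * d.N a.1 ^ 2)) :=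
              lintegral_Ioc_expProd_le (by positivity) (by positivity) (by positivity) T
            _ ≤ _ := by
              refine ENNReal.ofReal_le_ofReal ?_
              rw [div_le_iff₀ (by positivity)]
              rw [show 56.25 * C / π ^ 2 * (Nmin * d.N a.1 / (Nmax ^ 2 + d.N a.1 ^ 2)) *
                  (π ^ 2 * Nmax ^ 2 + 2 * π ^ 2 * d.N a.1 ^ 2) =
                  56.25 * C * Nmin * d.N a.1 * ((Nmax ^ 2 + 2 * d.N a.1 ^ 2) / (Nmax ^ 2 + d.N a.1 ^ 2)) by
                field_simp]
              have hq : 1 ≤ (Nmax ^ 2 + 2 * d.N a.1 ^ 2) / (Nmax ^ 2 + d.N a.1 ^ 2) := by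
                rw [le_div_iff₀ (by positivity)]; nlinarith
              have hX : 0 ≤ 56.25 * C * Nmin * d.N a.1 := by positivity
              calc 45 * d.α ^ 2 * d.bumpMass ^ 2 * Nmin * (d.α * (d.N a.1 + 2) * d.bumpMass)
                  = 45 * C * Nmin * (d.N a.1 + 2) := by rw [hC]; ring
                _ ≤ 56.25 * C * Nmin * d.N a.1 * 1 := by nlinarith [mul_nonneg hC0 hNmin0.le]
                _ ≤ 56.25 * C * Nmin * d.N a.1 * ((Nmax ^ 2 + 2 * d.N a.1 ^ 2) / (Nmax ^ 2 + d.N a.1 ^ 2)) :=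
                    mul_le_mul_of_nonneg_left hq hX
    _ ≤ ∑ p ∈ d.idx ×ˢ d.idx, ∑ a ∈ d.idx, ENNReal.ofReal ((56.25 * C / π ^ 2) *
          (min (d.N p.1.1) (d.N p.2.1) * d.N a.1 / (max (d.N p.1.1) (d.N p.2.1) ^ 2 + d.N a.1 ^ 2))) :=
        Finset.sum_le_sum_of_subset (Finset.filter_subset _ _)
    _ = ENNReal.ofReal (∑ a ∈ d.idx, ∑ p ∈ d.idx ×ˢ d.idx, (56.25 * C / π ^ 2) *
          (min (d.N p.1.1) (d.N p.2.1) * d.N a.1 / (max (d.N p.1.1) (d.N p.2.1) ^ 2 + d.N a.1 ^ 2))) := by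
        have hnn : ∀ (x y z : ℝ), 0 < x → 0 < y → 0 < z →
            0 ≤ (56.25 * C / π ^ 2) * (min x y * z / (max x y ^ 2 + z ^ 2)) :=
          fun x y z hx hy hz => mul_nonneg (by positivity)
            (div_nonneg (mul_nonneg (le_min hx.le hy.le) hz.le) (by positivity))
        rw [Finset.sum_comm, ENNReal.ofReal_sum_of_nonneg (fun a _ => Finset.sum_nonneg fun p _ =>
          hnn _ _ _ (d.N_pos _) (d.N_pos _) (d.N_pos _))]
        exact Finset.sum_congr rfl fun a _ =>
          (ENNReal.ofReal_sum_of_nonneg (fun p _ => hnn _ _ _ (d.N_pos _) (d.N_pos _) (d.N_pos _))).symm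
    _ = ENNReal.ofReal ((56.25 * C / π ^ 2) * (64 * ∑ s'' ∈ Finset.range d.r, ∑ s ∈ Finset.range d.r,
          ∑ s' ∈ Finset.range d.r, min (d.N s) (d.N s') * (d.N s'' / (max (d.N s) (d.N s') ^ 2 + d.N s'' ^ 2)))) := by
        congr 1
        rw [d.sum_idx (fun s'' => ∑ p ∈ d.idx ×ˢ d.idx, (56.25 * C / π ^ 2) *
          (min (d.N p.1.1) (d.N p.2.1) * d.N s'' / (max (d.N p.1.1) (d.N p.2.1) ^ 2 + d.N s'' ^ 2))), nsmul_eq_mul]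
        have hin : ∀ s'' : ℕ, ∑ p ∈ d.idx ×ˢ d.idx, (56.25 * C / π ^ 2) *
            (min (d.N p.1.1) (d.N p.2.1) * d.N s'' / (max (d.N p.1.1) (d.N p.2.1) ^ 2 + d.N s'' ^ 2)) =
            16 * ∑ s ∈ Finset.range d.r, ∑ s' ∈ Finset.range d.r, (56.25 * C / π ^ 2) *
              (min (d.N s) (d.N s') * d.N s'' / (max (d.N s) (d.N s') ^ 2 + d.N s'' ^ 2)) := by
          intro s''
          rw [d.sum_idx_idx (fun s s' => (56.25 * C / π ^ 2) *
            (min (d.N s) (d.N s') * d.N s'' / (max (d.N s) (d.N s') ^ 2 + d.N s'' ^ 2))), nsmul_eq_mul]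
          norm_num
        simp_rw [hin]
        push_cast
        simp only [Finset.mul_sum]
        refine Finset.sum_congr rfl fun s'' _ => Finset.sum_congr rfl fun s _ =>
          Finset.sum_congr rfl fun s' _ => ?_
        ring
    _ ≤ ENNReal.ofReal (656 * d.α ^ 3 * d.r * d.bumpMass ^ 3) := by
        refine ENNReal.ofReal_le_ofReal ?_
        -- the triple lacunary sum
        have htriple : ∑ s'' ∈ Finset.range d.r, ∑ s ∈ Finset.range d.r, ∑ s' ∈ Finset.range d.r,
            min (d.N s) (d.N s') * (d.N s'' / (max (d.N s) (d.N s') ^ 2 + d.N s'' ^ 2)) ≤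
            16 / 7 * (11 / 14 * d.r) := by
          have h1 : ∀ s'' ∈ Finset.range d.r, ∑ s ∈ Finset.range d.r, ∑ s' ∈ Finset.range d.r,
              min (d.N s) (d.N s') * (d.N s'' / (max (d.N s) (d.N s') ^ 2 + d.N s'' ^ 2)) ≤
              16 / 7 * ∑ s ∈ Finset.range d.r, d.N s * (d.N s'' / (d.N s ^ 2 + d.N s'' ^ 2)) := by
            intro s'' _
            exact d.pair_sum_min_max_le (fun yv => d.N s'' / (yv ^ 2 + d.N s'' ^ 2))
              (fun s => by have := d.N_pos s''; positivity)
          calc ∑ s'' ∈ Finset.range d.r, ∑ s ∈ Finset.range d.r, ∑ s' ∈ Finset.range d.r,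
                min (d.N s) (d.N s') * (d.N s'' / (max (d.N s) (d.N s') ^ 2 + d.N s'' ^ 2))
              ≤ ∑ s'' ∈ Finset.range d.r, 16 / 7 * ∑ s ∈ Finset.range d.r, d.N s * (d.N s'' / (d.N s ^ 2 + d.N s'' ^ 2)) :=
                Finset.sum_le_sum h1
            _ = 16 / 7 * ∑ s ∈ Finset.range d.r, ∑ s'' ∈ Finset.range d.r, d.N s * d.N s'' / (d.N s ^ 2 + d.N s'' ^ 2) := by
                rw [← Finset.mul_sum, Finset.sum_comm]
                congr 1
                refine Finset.sum_congr rfl fun s _ => Finset.sum_congr rfl fun s'' _ => ?_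
                ring
            _ ≤ 16 / 7 * (11 / 14 * d.r) := by
                have := d.lacunary_double_sum_le
                nlinarith
        have hfac : 0 ≤ 56.25 * C / π ^ 2 := by positivity
        calc 56.25 * C / π ^ 2 * (64 * ∑ s'' ∈ Finset.range d.r, ∑ s ∈ Finset.range d.r, ∑ s' ∈ Finset.range d.r,
              min (d.N s) (d.N s') * (d.N s'' / (max (d.N s) (d.N s') ^ 2 + d.N s'' ^ 2)))
            ≤ 56.25 * C / π ^ 2 * (64 * (16 / 7 * (11 / 14 * d.r))) := by
              apply mul_le_mul_of_nonneg_left _ hfac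
              linarith
          _ = (56.25 * 64 * (16 / 7) * (11 / 14) / π ^ 2) * (C * d.r) := by ring
          _ ≤ 656 * (C * d.r) := by
              apply mul_le_mul_of_nonneg_right _ (by positivity)
              rw [div_le_iff₀ (by positivity)]
              nlinarith
          _ = 656 * d.α ^ 3 * d.r * d.bumpMass ^ 3 := by rw [hC]; ring

/-- **The first forcing size**: `E₁ = ∫₀ᵀ massL1(u₁ r) massL1(Uᶜ r) dr ≤ 660 α³ r m³`
(`= 660 α Q² m³` with `Q² = α² r`). [cite: BourgainPavlovic2008, §3.3] -/
theorem forcing_E₁_le (T : ℝ) :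
    ∫⁻ r in Ioc 0 T, massL1 (d.secondIterate r) * massL1 (d.freeC r) ≤
      ENNReal.ofReal (660 * d.α ^ 3 * d.r * d.bumpMass ^ 3) := by
  have hα := d.α_pos.le
  have hm := d.bumpMass_nonneg
  have hN0 := d.eight_le_N 0
  have hN0pos := d.N_pos 0
  set w : ℝ≥0∞ := ENNReal.ofReal (48 * d.α ^ 2 * d.r * d.bumpMass ^ 2) with hw
  calc ∫⁻ r in Ioc 0 T, massL1 (d.secondIterate r) * massL1 (d.freeC r)
      ≤ ∫⁻ r in Ioc 0 T, (w * massL1 (d.freeC r) + d.highMass r * massL1 (d.freeC r)) := by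
        refine setLIntegral_mono' measurableSet_Ioc fun r hr => ?_
        rw [← add_mul]
        exact mul_le_mul' (d.massL1_secondIterate_le hr.1.le) le_rfl
    _ = (w * ∫⁻ r in Ioc 0 T, massL1 (d.freeC r)) + ∫⁻ r in Ioc 0 T, d.highMass r * massL1 (d.freeC r) := by
        rw [lintegral_add_left' ((measurable_massL1 d.continuous_freeC).aemeasurable.const_mul w),
          lintegral_const_mul' _ _ ENNReal.ofReal_ne_top]
    _ ≤ w * ENNReal.ofReal (0.32 * d.α * d.bumpMass / d.N 0) + ENNReal.ofReal (656 * d.α ^ 3 * d.r * d.bumpMass ^ 3) :=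
        add_le_add (mul_le_mul' le_rfl (d.lintegral_massL1_freeC_le T)) (d.lintegral_highMass_mul_freeC_le T)
    _ = ENNReal.ofReal (48 * d.α ^ 2 * d.r * d.bumpMass ^ 2 * (0.32 * d.α * d.bumpMass / d.N 0) +
          656 * d.α ^ 3 * d.r * d.bumpMass ^ 3) := by
        rw [hw, ← ENNReal.ofReal_mul (by positivity), ← ENNReal.ofReal_add (by positivity) (by positivity)]
    _ ≤ ENNReal.ofReal (660 * d.α ^ 3 * d.r * d.bumpMass ^ 3) := by
        refine ENNReal.ofReal_le_ofReal ?_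
        have hX : 0 ≤ d.α ^ 3 * d.r * d.bumpMass ^ 3 := by positivity
        have h1 : 48 * d.α ^ 2 * d.r * d.bumpMass ^ 2 * (0.32 * d.α * d.bumpMass / d.N 0) =
            (15.36 / d.N 0) * (d.α ^ 3 * d.r * d.bumpMass ^ 3) := by
          field_simp
          ring
        have h2 : 15.36 / d.N 0 ≤ 4 := by rw [div_le_iff₀ hN0pos]; linarith
        rw [h1]
        nlinarith [mul_le_mul_of_nonneg_right h2 hX]

/-- **The time integral of the high mass**: `∫₀ᵀ H(r) dr ≤ 191 α² m²/N_0`. [folklore] -/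
theorem lintegral_highMass_le (T : ℝ) :
    ∫⁻ r in Ioc 0 T, d.highMass r ≤ ENNReal.ofReal (191 * d.α ^ 2 * d.bumpMass ^ 2 / d.N 0) := by
  classical
  have hα := d.α_pos.le
  have hm := d.bumpMass_nonneg
  have hπ := Real.pi_gt_d2
  have hπ2 : (9.8596 : ℝ) ≤ π ^ 2 := by nlinarith
  have hN0pos := d.N_pos 0
  set C : ℝ := d.α ^ 2 * d.bumpMass ^ 2 with hC
  have hC0 : 0 ≤ C := by positivity
  set h : ℝ → ℝ := fun yv => (45 * C / π ^ 2) / yv ^ 2 with hh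
  have hh0 : ∀ s, 0 ≤ h (d.N s) := fun s => by simp only [hh]; have := d.N_pos s; positivity
  calc ∫⁻ r in Ioc 0 T, d.highMass r = ∑ p ∈ d.highPairs, ∫⁻ r in Ioc 0 T, massL1 (d.pairTerm p.1 p.2 r) :=
        lintegral_finsetSum' _ fun p _ => (measurable_massL1 (d.continuous_pairTerm p.1 p.2)).aemeasurable
    _ ≤ ∑ p ∈ d.highPairs, ENNReal.ofReal (min (d.N p.1.1) (d.N p.2.1) * h (max (d.N p.1.1) (d.N p.2.1))) := by
        refine Finset.sum_le_sum fun p hp => ?_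
        have hnl : ¬IsLowPair p.1 p.2 := (Finset.mem_filter.1 hp).2
        have hNmin0 : 0 < min (d.N p.1.1) (d.N p.2.1) := lt_min (d.N_pos _) (d.N_pos _)
        have hNmax8 : 8 ≤ max (d.N p.1.1) (d.N p.2.1) := le_max_of_le_left (d.eight_le_N _)
        have hκ : 0 < π ^ 2 * max (d.N p.1.1) (d.N p.2.1) ^ 2 := by positivity
        calc ∫⁻ r in Ioc 0 T, massL1 (d.pairTerm p.1 p.2 r)
            ≤ ∫⁻ r in Ioc 0 T, ENNReal.ofReal (45 * C * min (d.N p.1.1) (d.N p.2.1)) *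
                ENNReal.ofReal (Real.exp (-(π ^ 2 * max (d.N p.1.1) (d.N p.2.1) ^ 2) * r)) := by
              refine setLIntegral_mono' measurableSet_Ioc fun r hr => ?_
              rw [← ENNReal.ofReal_mul (by positivity)]
              have h1 := d.massL1_pairTerm_le_of_not_low hnl hr.1.le
              calc massL1 (d.pairTerm p.1 p.2 r) ≤ _ := h1
                _ = _ := by rw [hC]; ring_nf
          _ ≤ ENNReal.ofReal (45 * C * min (d.N p.1.1) (d.N p.2.1)) *
                ENNReal.ofReal (1 / (π ^ 2 * max (d.N p.1.1) (d.N p.2.1) ^ 2)) := by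
              rw [lintegral_const_mul' _ _ ENNReal.ofReal_ne_top]
              exact mul_le_mul' le_rfl (lintegral_Ioc_exp_neg_le hκ T)
          _ = ENNReal.ofReal (min (d.N p.1.1) (d.N p.2.1) * h (max (d.N p.1.1) (d.N p.2.1))) := by
              rw [← ENNReal.ofReal_mul (by positivity)]
              congr 1
              simp only [hh]
              field_simp
    _ ≤ ∑ p ∈ d.idx ×ˢ d.idx, ENNReal.ofReal (min (d.N p.1.1) (d.N p.2.1) * h (max (d.N p.1.1) (d.N p.2.1))) :=
        Finset.sum_le_sum_of_subset (Finset.filter_subset _ _)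
    _ = ENNReal.ofReal (16 * ∑ s ∈ Finset.range d.r, ∑ s' ∈ Finset.range d.r,
          min (d.N s) (d.N s') * h (max (d.N s) (d.N s'))) := by
        rw [← ENNReal.ofReal_sum_of_nonneg (fun p _ => mul_nonneg (le_min (d.N_pos _).le (d.N_pos _).le)
          (by rcases max_cases (d.N p.1.1) (d.N p.2.1) with ⟨h1, _⟩ | ⟨h1, _⟩ <;> rw [h1] <;> exact hh0 _)),
          d.sum_idx_idx (fun s s' => min (d.N s) (d.N s') * h (max (d.N s) (d.N s'))), nsmul_eq_mul]
        norm_num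
    _ ≤ ENNReal.ofReal (191 * d.α ^ 2 * d.bumpMass ^ 2 / d.N 0) := by
        refine ENNReal.ofReal_le_ofReal ?_
        have h1 := d.pair_sum_min_max_le h hh0
        have h2 : ∑ s ∈ Finset.range d.r, d.N s * h (d.N s) = (45 * C / π ^ 2) * ∑ s ∈ Finset.range d.r, 1 / d.N s := by
          rw [Finset.mul_sum]
          refine Finset.sum_congr rfl fun s _ => ?_
          simp only [hh]
          have := d.N_pos s
          field_simp
        have h3 := d.sum_inv_N_le
        have h4 : 45 * C / π ^ 2 ≤ 45 * C / 9.8596 := div_le_div_of_nonneg_left (by positivity) (by norm_num) hπ2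
        have h5 : 0 ≤ ∑ s ∈ Finset.range d.r, 1 / d.N s := Finset.sum_nonneg fun s _ => by
          have := d.N_pos s; positivity
        rw [h2] at h1
        calc 16 * ∑ s ∈ Finset.range d.r, ∑ s' ∈ Finset.range d.r, min (d.N s) (d.N s') * h (max (d.N s) (d.N s'))
            ≤ 16 * (16 / 7 * (45 * C / π ^ 2 * ∑ s ∈ Finset.range d.r, 1 / d.N s)) := by linarith
          _ ≤ 16 * (16 / 7 * (45 * C / 9.8596 * (8 / 7 / d.N 0))) := by
              gcongr
          _ = (16 * 16 * 45 * 8 / (7 * 7 * 9.8596)) * (C / d.N 0) := by field_simp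
          _ ≤ 191 * (C / d.N 0) := mul_le_mul_of_nonneg_right (by norm_num) (by positivity)
          _ = 191 * d.α ^ 2 * d.bumpMass ^ 2 / d.N 0 := by rw [hC]; ring

/-- **The square of the high mass in time**: `∫₀ᵀ H(r)² dr ≤ 216000 α⁴ r m⁴` (quadruple lacunary
sum; the almost-orthogonality in time of distinct scales keeps it linear in `r`). [cite: BourgainPavlovic2008, §3.3] -/
theorem lintegral_highMass_sq_le (T : ℝ) :
    ∫⁻ r in Ioc 0 T, d.highMass r * d.highMass r ≤ ENNReal.ofReal (216000 * d.α ^ 4 * d.r * d.bumpMass ^ 4) := by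
  classical
  have hα := d.α_pos.le
  have hm := d.bumpMass_nonneg
  have hπ := Real.pi_gt_d2
  have hπ2 : (9.8596 : ℝ) ≤ π ^ 2 := by nlinarith
  set C : ℝ := d.α ^ 4 * d.bumpMass ^ 4 with hC
  have hC0 : 0 ≤ C := by positivity
  -- the summand as a function of the four scales
  set F : ℕ → ℕ → ℕ → ℕ → ℝ := fun s s' t t' => (2025 * C / π ^ 2) *
    (min (d.N s) (d.N s') * min (d.N t) (d.N t') / (max (d.N s) (d.N s') ^ 2 + max (d.N t) (d.N t') ^ 2)) with hF
  have hF0 : ∀ s s' t t', 0 ≤ F s s' t t' := fun s s' t t' => by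
    simp only [hF]
    have := d.N_pos s; have := d.N_pos s'; have := d.N_pos t; have := d.N_pos t'
    exact mul_nonneg (by positivity) (div_nonneg (mul_nonneg (le_min (by positivity) (by positivity))
      (le_min (by positivity) (by positivity))) (by positivity))
  calc ∫⁻ r in Ioc 0 T, d.highMass r * d.highMass r
      = ∫⁻ r in Ioc 0 T, ∑ p ∈ d.highPairs, ∑ q ∈ d.highPairs,
          massL1 (d.pairTerm p.1 p.2 r) * massL1 (d.pairTerm q.1 q.2 r) := by
        refine lintegral_congr fun r => ?_
        rw [highMass, Finset.sum_mul_sum]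
    _ = ∑ p ∈ d.highPairs, ∫⁻ r in Ioc 0 T, ∑ q ∈ d.highPairs,
          massL1 (d.pairTerm p.1 p.2 r) * massL1 (d.pairTerm q.1 q.2 r) :=
        lintegral_finsetSum' _ fun p _ => (Finset.measurable_sum _ fun q _ =>
          ((measurable_massL1 (d.continuous_pairTerm p.1 p.2)).mul
            (measurable_massL1 (d.continuous_pairTerm q.1 q.2)))).aemeasurable
    _ = ∑ p ∈ d.highPairs, ∑ q ∈ d.highPairs, ∫⁻ r in Ioc 0 T,
          massL1 (d.pairTerm p.1 p.2 r) * massL1 (d.pairTerm q.1 q.2 r) :=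
        Finset.sum_congr rfl fun p _ => lintegral_finsetSum' _ fun q _ =>
          ((measurable_massL1 (d.continuous_pairTerm p.1 p.2)).mul
            (measurable_massL1 (d.continuous_pairTerm q.1 q.2))).aemeasurable
    _ ≤ ∑ p ∈ d.highPairs, ∑ q ∈ d.highPairs, ENNReal.ofReal (F p.1.1 p.2.1 q.1.1 q.2.1) := by
        refine Finset.sum_le_sum fun p hp => Finset.sum_le_sum fun q hq => ?_
        have hnp : ¬IsLowPair p.1 p.2 := (Finset.mem_filter.1 hp).2
        have hnq : ¬IsLowPair q.1 q.2 := (Finset.mem_filter.1 hq).2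
        have h1 : 0 < min (d.N p.1.1) (d.N p.2.1) := lt_min (d.N_pos _) (d.N_pos _)
        have h2 : 0 < min (d.N q.1.1) (d.N q.2.1) := lt_min (d.N_pos _) (d.N_pos _)
        have h3 : 8 ≤ max (d.N p.1.1) (d.N p.2.1) := le_max_of_le_left (d.eight_le_N _)
        have h4 : 8 ≤ max (d.N q.1.1) (d.N q.2.1) := le_max_of_le_left (d.eight_le_N _)
        calc ∫⁻ r in Ioc 0 T, massL1 (d.pairTerm p.1 p.2 r) * massL1 (d.pairTerm q.1 q.2 r)
            ≤ ∫⁻ r in Ioc 0 T,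
                ENNReal.ofReal (45 * d.α ^ 2 * d.bumpMass ^ 2 * min (d.N p.1.1) (d.N p.2.1) *
                  Real.exp (-(π ^ 2 * max (d.N p.1.1) (d.N p.2.1) ^ 2) * r)) *
                ENNReal.ofReal (45 * d.α ^ 2 * d.bumpMass ^ 2 * min (d.N q.1.1) (d.N q.2.1) *
                  Real.exp (-(π ^ 2 * max (d.N q.1.1) (d.N q.2.1) ^ 2) * r)) :=
              setLIntegral_mono' measurableSet_Ioc fun r hr => mul_le_mul'
                (d.massL1_pairTerm_le_of_not_low hnp hr.1.le) (d.massL1_pairTerm_le_of_not_low hnq hr.1.le)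
          _ ≤ ENNReal.ofReal (45 * d.α ^ 2 * d.bumpMass ^ 2 * min (d.N p.1.1) (d.N p.2.1) *
                (45 * d.α ^ 2 * d.bumpMass ^ 2 * min (d.N q.1.1) (d.N q.2.1)) /
                (π ^ 2 * max (d.N p.1.1) (d.N p.2.1) ^ 2 + π ^ 2 * max (d.N q.1.1) (d.N q.2.1) ^ 2)) :=
              lintegral_Ioc_expProd_le (by positivity) (by positivity) (by positivity) T
          _ = ENNReal.ofReal (F p.1.1 p.2.1 q.1.1 q.2.1) := by
              congr 1
              simp only [hF, hC]
              field_simp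
              ring
    _ ≤ ∑ p ∈ d.idx ×ˢ d.idx, ∑ q ∈ d.idx ×ˢ d.idx, ENNReal.ofReal (F p.1.1 p.2.1 q.1.1 q.2.1) := by
        calc ∑ p ∈ d.highPairs, ∑ q ∈ d.highPairs, ENNReal.ofReal (F p.1.1 p.2.1 q.1.1 q.2.1)
            ≤ ∑ p ∈ d.highPairs, ∑ q ∈ d.idx ×ˢ d.idx, ENNReal.ofReal (F p.1.1 p.2.1 q.1.1 q.2.1) :=
              Finset.sum_le_sum fun p _ => Finset.sum_le_sum_of_subset (Finset.filter_subset _ _)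
          _ ≤ _ := Finset.sum_le_sum_of_subset (Finset.filter_subset _ _)
    _ = ENNReal.ofReal (∑ p ∈ d.idx ×ˢ d.idx, ∑ q ∈ d.idx ×ˢ d.idx, F p.1.1 p.2.1 q.1.1 q.2.1) := by
        rw [ENNReal.ofReal_sum_of_nonneg (fun p _ => Finset.sum_nonneg fun q _ => hF0 _ _ _ _)]
        exact Finset.sum_congr rfl fun p _ => (ENNReal.ofReal_sum_of_nonneg (fun q _ => hF0 _ _ _ _)).symm
    _ = ENNReal.ofReal (256 * ∑ s ∈ Finset.range d.r, ∑ s' ∈ Finset.range d.r,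
          ∑ t ∈ Finset.range d.r, ∑ t' ∈ Finset.range d.r, F s s' t t') := by
        congr 1
        rw [d.sum_idx_idx (fun s s' => ∑ q ∈ d.idx ×ˢ d.idx, F s s' q.1.1 q.2.1), nsmul_eq_mul]
        have hin : ∀ s s', ∑ q ∈ d.idx ×ˢ d.idx, F s s' q.1.1 q.2.1 =
            16 * ∑ t ∈ Finset.range d.r, ∑ t' ∈ Finset.range d.r, F s s' t t' := by
          intro s s'
          rw [d.sum_idx_idx (fun t t' => F s s' t t'), nsmul_eq_mul]
          norm_num
        simp_rw [hin]
        push_cast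
        simp only [Finset.mul_sum]
        refine Finset.sum_congr rfl fun _ _ => Finset.sum_congr rfl fun _ _ =>
          Finset.sum_congr rfl fun _ _ => Finset.sum_congr rfl fun _ _ => ?_
        ring
    _ ≤ ENNReal.ofReal (216000 * d.α ^ 4 * d.r * d.bumpMass ^ 4) := by
        refine ENNReal.ofReal_le_ofReal ?_
        -- inner pair sum in `(t, t')` for fixed `(s, s')`, then outer pair sum in `(s, s')`
        have hinner : ∀ s s', ∑ t ∈ Finset.range d.r, ∑ t' ∈ Finset.range d.r, F s s' t t' ≤
            (2025 * C / π ^ 2) * min (d.N s) (d.N s') *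
              (16 / 7 * ∑ t ∈ Finset.range d.r, d.N t * (1 / (max (d.N s) (d.N s') ^ 2 + d.N t ^ 2))) := by
          intro s s'
          set M := max (d.N s) (d.N s') with hM
          have h1 := d.pair_sum_min_max_le (fun yv => 1 / (M ^ 2 + yv ^ 2)) (fun t => by positivity)
          have hmin0 : 0 ≤ min (d.N s) (d.N s') := le_min (d.N_pos _).le (d.N_pos _).le
          have heq : ∑ t ∈ Finset.range d.r, ∑ t' ∈ Finset.range d.r, F s s' t t' =
              (2025 * C / π ^ 2) * min (d.N s) (d.N s') *
                ∑ t ∈ Finset.range d.r, ∑ t' ∈ Finset.range d.r,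
                  min (d.N t) (d.N t') * (1 / (M ^ 2 + max (d.N t) (d.N t') ^ 2)) := by
            simp only [hF, Finset.mul_sum]
            refine Finset.sum_congr rfl fun t _ => Finset.sum_congr rfl fun t' _ => ?_
            rw [hM]; ring
          rw [heq]
          exact mul_le_mul_of_nonneg_left h1 (by positivity)
        have houter : ∑ s ∈ Finset.range d.r, ∑ s' ∈ Finset.range d.r,
            (2025 * C / π ^ 2) * min (d.N s) (d.N s') *
              (16 / 7 * ∑ t ∈ Finset.range d.r, d.N t * (1 / (max (d.N s) (d.N s') ^ 2 + d.N t ^ 2))) ≤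
            16 / 7 * ∑ s ∈ Finset.range d.r, d.N s * ((2025 * C / π ^ 2) *
              (16 / 7 * ∑ t ∈ Finset.range d.r, d.N t * (1 / (d.N s ^ 2 + d.N t ^ 2)))) := by
          have h1 := d.pair_sum_min_max_le
            (fun yv => (2025 * C / π ^ 2) * (16 / 7 * ∑ t ∈ Finset.range d.r, d.N t * (1 / (yv ^ 2 + d.N t ^ 2))))
            (fun s => mul_nonneg (by positivity) (mul_nonneg (by norm_num)
              (Finset.sum_nonneg fun t _ => by have := d.N_pos t; positivity)))
          refine le_trans (le_of_eq ?_) h1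
          refine Finset.sum_congr rfl fun s _ => Finset.sum_congr rfl fun s' _ => ?_
          ring
        have hdouble : ∑ s ∈ Finset.range d.r, d.N s * ((2025 * C / π ^ 2) *
            (16 / 7 * ∑ t ∈ Finset.range d.r, d.N t * (1 / (d.N s ^ 2 + d.N t ^ 2)))) =
            (2025 * C / π ^ 2) * (16 / 7) * ∑ s ∈ Finset.range d.r, ∑ t ∈ Finset.range d.r,
              d.N s * d.N t / (d.N s ^ 2 + d.N t ^ 2) := by
          simp only [Finset.mul_sum]
          refine Finset.sum_congr rfl fun s _ => Finset.sum_congr rfl fun t _ => ?_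
          ring
        have hlac := d.lacunary_double_sum_le
        have hfac : 0 ≤ 2025 * C / π ^ 2 := by positivity
        calc 256 * ∑ s ∈ Finset.range d.r, ∑ s' ∈ Finset.range d.r,
              ∑ t ∈ Finset.range d.r, ∑ t' ∈ Finset.range d.r, F s s' t t'
            ≤ 256 * ∑ s ∈ Finset.range d.r, ∑ s' ∈ Finset.range d.r,
                (2025 * C / π ^ 2) * min (d.N s) (d.N s') *
                  (16 / 7 * ∑ t ∈ Finset.range d.r, d.N t * (1 / (max (d.N s) (d.N s') ^ 2 + d.N t ^ 2))) := by
              gcongr with s _ s' _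
              exact hinner s s'
          _ ≤ 256 * (16 / 7 * ∑ s ∈ Finset.range d.r, d.N s * ((2025 * C / π ^ 2) *
              (16 / 7 * ∑ t ∈ Finset.range d.r, d.N t * (1 / (d.N s ^ 2 + d.N t ^ 2))))) := by linarith
          _ = 256 * (16 / 7) * ((2025 * C / π ^ 2) * (16 / 7)) * ∑ s ∈ Finset.range d.r, ∑ t ∈ Finset.range d.r,
              d.N s * d.N t / (d.N s ^ 2 + d.N t ^ 2) := by rw [hdouble]; ring
          _ ≤ 256 * (16 / 7) * ((2025 * C / π ^ 2) * (16 / 7)) * (11 / 14 * d.r) :=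
              mul_le_mul_of_nonneg_left hlac (by positivity)
          _ = (256 * (16 / 7) * 2025 * (16 / 7) * (11 / 14) / π ^ 2) * (C * d.r) := by ring
          _ ≤ 216000 * (C * d.r) := by
              apply mul_le_mul_of_nonneg_right _ (by positivity)
              rw [div_le_iff₀ (by positivity)]
              nlinarith
          _ = 216000 * d.α ^ 4 * d.r * d.bumpMass ^ 4 := by rw [hC]; ring

/-- **The second forcing size**: `E₂ = ∫₀ᵀ massL1(u₁ r)² dr ≤ 2304 α⁴ r² m⁴ T + 219000 α⁴ m⁴ r`
(`= 2304 Q⁴ m⁴ T + 219000 α² Q² m⁴`). [cite: BourgainPavlovic2008, §3.3] -/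
theorem forcing_E₂_le {T : ℝ} (hT : 0 ≤ T) :
    ∫⁻ r in Ioc 0 T, massL1 (d.secondIterate r) * massL1 (d.secondIterate r) ≤
      ENNReal.ofReal (2304 * d.α ^ 4 * d.r ^ 2 * d.bumpMass ^ 4 * T + 219000 * d.α ^ 4 * d.bumpMass ^ 4 * d.r) := by
  have hα := d.α_pos.le
  have hm := d.bumpMass_nonneg
  have hN0 := d.eight_le_N 0
  have hN0pos := d.N_pos 0
  set wr : ℝ := 48 * d.α ^ 2 * d.r * d.bumpMass ^ 2 with hwr
  have hwr0 : 0 ≤ wr := by positivity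
  set w : ℝ≥0∞ := ENNReal.ofReal wr with hw
  have hH := d.measurable_highMass
  calc ∫⁻ r in Ioc 0 T, massL1 (d.secondIterate r) * massL1 (d.secondIterate r)
      ≤ ∫⁻ r in Ioc 0 T, (w + d.highMass r) * (w + d.highMass r) :=
        setLIntegral_mono' measurableSet_Ioc fun r hr =>
          mul_le_mul' (d.massL1_secondIterate_le hr.1.le) (d.massL1_secondIterate_le hr.1.le)
    _ = ∫⁻ r in Ioc 0 T, (w * w + (w * d.highMass r + w * d.highMass r) + d.highMass r * d.highMass r) := by
        refine lintegral_congr fun r => ?_; ring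
    _ = w * w * volume (Ioc (0 : ℝ) T) + ((w * ∫⁻ r in Ioc 0 T, d.highMass r) + (w * ∫⁻ r in Ioc 0 T, d.highMass r)) +
          ∫⁻ r in Ioc 0 T, d.highMass r * d.highMass r := by
        have hHa : AEMeasurable d.highMass (volume.restrict (Ioc 0 T)) := hH.aemeasurable
        rw [lintegral_add_right' _ (show AEMeasurable (fun r => d.highMass r * d.highMass r) _ from hHa.mul hHa),
          lintegral_add_left' (show AEMeasurable (fun _ : ℝ => w * w) _ from aemeasurable_const),
          lintegral_add_left' (show AEMeasurable (fun r => w * d.highMass r) _ from hHa.const_mul w),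
          lintegral_const_mul _ hH, setLIntegral_const]
    _ ≤ w * w * ENNReal.ofReal T + ((w * ENNReal.ofReal (191 * d.α ^ 2 * d.bumpMass ^ 2 / d.N 0)) +
          (w * ENNReal.ofReal (191 * d.α ^ 2 * d.bumpMass ^ 2 / d.N 0))) +
          ENNReal.ofReal (216000 * d.α ^ 4 * d.r * d.bumpMass ^ 4) := by
        rw [Real.volume_Ioc, sub_zero]
        exact add_le_add (add_le_add le_rfl (add_le_add (mul_le_mul' le_rfl (d.lintegral_highMass_le T))
          (mul_le_mul' le_rfl (d.lintegral_highMass_le T)))) (d.lintegral_highMass_sq_le T)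
    _ = ENNReal.ofReal (wr * wr * T + (wr * (191 * d.α ^ 2 * d.bumpMass ^ 2 / d.N 0) +
          wr * (191 * d.α ^ 2 * d.bumpMass ^ 2 / d.N 0)) + 216000 * d.α ^ 4 * d.r * d.bumpMass ^ 4) := by
        rw [hw, ← ENNReal.ofReal_mul hwr0, ← ENNReal.ofReal_mul (by positivity), ← ENNReal.ofReal_mul hwr0,
          ← ENNReal.ofReal_add (by positivity) (by positivity),
          ← ENNReal.ofReal_add (by positivity) (by positivity), ← ENNReal.ofReal_add (by positivity) (by positivity)]
    _ ≤ _ := by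
        refine ENNReal.ofReal_le_ofReal ?_
        have hX : 0 ≤ d.α ^ 4 * d.bumpMass ^ 4 * d.r := by positivity
        have h1 : wr * wr * T = 2304 * d.α ^ 4 * d.r ^ 2 * d.bumpMass ^ 4 * T := by rw [hwr]; ring
        have h2 : wr * (191 * d.α ^ 2 * d.bumpMass ^ 2 / d.N 0) = (9168 / d.N 0) * (d.α ^ 4 * d.bumpMass ^ 4 * d.r) := by
          rw [hwr]; field_simp; ring
        have h3 : 9168 / d.N 0 ≤ 1500 := by rw [div_le_iff₀ hN0pos]; linarith
        rw [h1, h2]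
        nlinarith [mul_le_mul_of_nonneg_right h3 hX]

end InflationParams

end Literature.Analysis.FluidPDE.BourgainPavlovic
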